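import Literature.AlgebraicGeometry.ComplexMultiplication.CyclotomicFermatCMTypesBoundaryCaseTwoAtSeven
import HarnessLib

/-!
# Koblitz–Rohrlich §3 PROPOSITION, CASE 3 AT `p = 5` WITH `5 ∥ N` — the step K–R OMIT ("By a tedious examination … The details will be
# omitted", p. 1197) — SETTLED; hence THE PROPOSITION, and THEOREM 1 (ii) for boundary triples on abelian varieties, AT EVERY LEVEL `N`
# PRIME TO `6`, with no level clause and no regime clause left

Layer `Literature/AlgebraicGeometry/ComplexMultiplication`, namespace `…ComplexMultiplication.CyclotomicFermatCMType`; sequel of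
`CyclotomicFermatCMTypesBoundaryCaseTwoAtSeven` (this lane, gen 40, v1–v5), whose honest column reads after v5: «the one boundary configuration
of K–R's Proposition outside the tree is CASE 3 at `p = 5` with `5 ∥ N` — "`5 | N, r`, `5 ∤ str′s′t′`" —, whose proof K–R OMIT; their reduction
to `τ = (5, N − a, N − b)` and the criterion (10) are not typed either».  THIS FILE types that reduction and criterion (10) AS PRINTED, settles
the omitted step by a different road (an orbit-sum argument for `N/5 > 20` and kernel computations at the five levels `N ≤ 95` concerned), and
assembles the Proposition and Theorem 1 (ii) for boundary triples at every level prime to `6`.  (A separate file because the sibling reached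
the gate's size cap; the elementary private helpers of §0 are copies of the sibling's.)
THEOREMS ONLY (no definition, no named fact, no `sorry`; kernel `decide` for two digit lemmas (`a, i < 5`, `Q mod 5`) and five separating-unit
searches over all pairs `(r′, s′)` modulo `35, 55, 65, 85, 95`; no `native_decide`).

THE SOURCE.  N. Koblitz, D. Rohrlich, *Simple factors in the Jacobian of a Fermat curve*, Canad. J. Math. **30** (1978) 1183–1205 (held
`paper:koblitz1978-simple-factors-jacobian-fermat-curve`, pp. 1193–1197 read first-hand), §3 Proposition (p. 1193), Case 3 (pp. 1196–1197):
"Case 3. There exists a prime `p` such that `p | N, r`, but `p ∤ str′s′t′`. … (8) `νN ≥ Σ_{u∈P} ⟨ur⟩ + ⟨us⟩ + ⟨ut⟩ − Σ_{u∈P} ⟨ur′⟩ + ⟨us′⟩ +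
⟨ut′⟩ = pr + Σ (s₀ + iN/p + t₀ + iN/p − r₀′ − iN/p − s₀′ − iN/p − t₀′ − iN/p) ≥ pr + p(s₀ + t₀) − p(r₀′ + s₀′ + t₀′) − (p − 1)N/2` … We now
consider the case `p = 5`, `5² ∤ N`.  If `r > 5`, there is a prime `q > 5` dividing `r` and `N`, and we can use Case 1, 2, or 3 with `p = q > 5`.
So suppose `r = 5`.  By (8), `N/5 ≥ 2N/5 + r₀′ + s₀′ + t₀′ − (5 + s₀ + t₀)`, which is only possible if `r₀′ + s₀′ + t₀′ = N/5`, `5 + s₀ + t₀ =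
2N/5`.  Thus, `τ = (5, iN/5 − a, jN/5 − b)`, where `a, b > 0`, `a + b = 5`.  Multiplying through by a suitable element in `P*`, without loss
of generality we may assume that `τ = (5, N − a, N − b)`.  But for this `τ` we know `H_τ ⊂ (ℤ/Nℤ)*` explicitly. Namely, if `h ∈ (ℤ/Nℤ)*`,
then (10) `h ∈ H_τ ⟺ [5⟨h⟩/N] + [a⟨h⟩/N] + [b⟨h⟩/N]` is odd.  By a tedious examination of the possible `τ′` for which `r₀′ + s₀′ + t₀′ = N/5`
and `H_{τ′}` is given by (10) we verify that no such `τ′` exists. The details will be omitted."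

THE POINT (ours, in place of the omitted examination).  Let `Q = N/5`, `h₀ = Q − 5` (a unit: `Q` is prime to `30`), and run through the
orbit `u_i = h₀(1 + iQ)`, `i < 5` — as a set, the five lifts `h₀ + cQ` of `h₀ mod Q`, of which exactly one (`N − 5`) is a non-unit.  For
`τ = (5, N − a, N − b)` with `5a, 5b < Q` one has `⟨h₀·5⟩ = N − 25`, `⟨h₀(N − a)⟩ = bQ + 5a`, `⟨h₀(N − b)⟩ = aQ + 5b`, and along the orbit the
`Q`-digits of the last two move as `(b(1 + iQ)) mod 5`, `(a(1 + iQ)) mod 5`, which add up to `5` at every unit point: so `⟨u_i r⟩ + ⟨u_i x⟩ +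
⟨u_i z⟩ = 2N` and NO unit point of the orbit lies in `H_τ`.  If `H_τ = H_{τ′}` with `5 ∤ ⟨r′⟩⟨s′⟩⟨t′⟩`, the four unit points contribute `2N`
each to the `τ′`-orbit sum and the non-unit point at least `N` (primitivity), total `≥ 9N`; but the sibling's orbit-sum formula
(`two_mul_sum_val_orbit_mul`, K–R's "`Σ_{u∈P} ⟨ux⟩ = p·x₀ + Σ iN/p`") gives `2Σ = 10(r₀″ + s₀″ + t₀″) + 12N < 18N`.  For `Q ≤ 20` (i.e. `N ∈
{35, 55, 65, 85, 95}`; at `Q ∈ {17, 19}` only `{a, b} = {1, 4}` is small) no `P`-coset has all its unit points on one side of `H_τ`, and a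
separating unit is found by kernel computation for every `τ′`.

## What is proved

* §0 private copies of the sibling's elementary helpers (`_ct`).
* §1 CASE 3 AT `p = 5`, `5 ∥ N` (p. 1197).  As printed: the residue relation in Case 3 (`relation_three_ct`), its equality case "`r₀′ + s₀′ +
  t₀′ = N/5`, `5 + s₀ + t₀ = 2N/5`" (`residues_three_ct`), the reduction "So suppose `r = 5`" (`gcd_eq_five_three_ct`, via Case 2 at every
  prime, sibling §8), **`mem_fermatCMType_five_iff`** = CRITERION (10), **`case_three_five_reduction`** ("without loss of generality we may
  assume that `τ = (5, N − a, N − b)`": a unit `u` and `a ∈ {1, …, 4}` with `uτ = (5, N − a, N − b)` on representatives, `H_{uτ} = H_{uτ′}`,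
  `5 ∤ ⟨ur′⟩⟨us′⟩⟨ut′⟩`, `⟨ur′⟩₀ + ⟨us′⟩₀ + ⟨ut′⟩₀ = N/5`).  Then, in place of the omitted examination (OURS): `false_of_large_three_ct` (the
  orbit of `h₀ = Q − 5` for `Q > 5·max(a, b)`, as in THE POINT) and `false_of_small_three_ct` (kernel searches `witness_…_ct` at `N ∈ {35, 55,
  65, 85, 95}`; by the symmetry `a ↔ b` only `a ∈ {1, 2}`, and at `85, 95` only `a = 1`).  Hence **`fermatCMType_ne_of_five_dvd_of_not_dvd`**
  (+ `_level`) = CASE 3 AT `p = 5`, `5 ∥ N`: `5 ∣ ⟨r⟩`, `5 ∤ ⟨r′⟩, ⟨s′⟩, ⟨t′⟩ ⟹ H_τ ≠ H_{τ′}`, and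
  **`eq_or_eq_or_eq_of_fermatCMType_eq_of_five_dvd_exact`** (at `5 ∥ N`: `5 ∣ ⟨r⟩ ⟹ r ∈ {r′, s′, t′}`, no proviso; Case 2 is the sibling's §8).
* §2 AT EVERY LEVEL `N` PRIME TO `6`, ANY BOUNDARY PRIMES, NO CLAUSE: **`eq_or_eq_or_eq_of_fermatCMType_eq_of_dvd_all`** (`p ∣ N`, `p ∣ ⟨r⟩ ⟹
  r ∈ {r′, s′, t′}`), `multiset_eq_of_fermatCMType_eq_of_eq_of_dvd_all`, **`multiset_eq_of_fermatCMType_eq_of_dvd_of_dvd_all`** = THE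
  PROPOSITION, **`multiset_eq_of_fermatCMType_eq_of_gcd_six_all`** (printed hypotheses "g.c.d.`(r,s,t,r′,s′,t′) = 1`") and
  **`isIsogenous_iff_exists_unit_multiset_eq_all`** = THEOREM 1 (ii) FOR BOUNDARY TRIPLES ON ABELIAN VARIETIES — superseding the sibling's
  `…_of_not_five_or_sq` family and every regime form of gen 39.

## Honest column / NOT here

* The one step of §3 K–R do not print — the "tedious examination" via (10) — is NOT reconstructed as such: it is REPLACED by the orbit-sum
  argument (which uses neither (10) nor `r₀′ + s₀′ + t₀′ = N/5`) for `N/5 > 5·max(a, b)` and by kernel searches at the five levels `N ≤ 95`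
  concerned; criterion (10) is typed as printed but not used in the proof.  The proof of (10) is the elementary digit count `⌊5y⌋ − ⌊ay⌋ −
  ⌊by⌋ ∈ {0, 1}` (`y = ⟨h⟩/N`), with `⟨h(N − a)⟩ = N − ⟨ah⟩`.
* With this file EVERY configuration of K–R's §3 Proposition is a tree theorem at every level prime to `6`.  What remains outside the tree of
  K–R §§1–3 is the JUNCTION with §2 of the paper for Theorem 1 (i) as one statement over all triples: the relatively prime case at every level
  prime to `6` is the tree's `CyclotomicFermatCMTypesCoprimeSixLevelSimple`, the boundary case is §2 here, and the configuration "`r = r′`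
  non-unit, `s, t, s′, t′` units" — excluded by the Proposition's hypothesis "in the case that `r = r′` …, `N` is not prime to `sts′t′`" —
  amounts to the pair analogue `G(s) + G(t) = G(s′) + G(t′)` of §2's (∗), not typed.
* Conventions as in the siblings: "`p ∣ x`" on representatives (`p ∣ ⟨x⟩`); "`τ, τ′` primitive" is K–R's "g.c.d. `= 1`" after Case 1
  (`primitive_of_fermatCMType_eq_of_gcd_six`); K–R's triples have `r + s + t = N`, here non-zero residues with `r + s + t ≡ 0`.
* Kernel `decide`: `digits_large_ct`, `unique_nonunit_ct` (after `interval_cases`), and the five searches `witness_thirtyFive∕fiftyFive∕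
  sixtyFive∕eightyFive∕ninetyFive_ct` (`maxRecDepth 100000`, `maxHeartbeats 4000000`; together ≈ 1 min of elaboration); no character sums.

## References

* [KoblitzRohrlich1978] N. Koblitz, D. Rohrlich, Canad. J. Math. 30 (1978) 1183–1205: Theorem 1 (p. 1185), §3 Proposition (p. 1193),
  Case 3 and (8)–(10) (pp. 1196–1197), Case 2 (pp. 1195–1196).
* [Shimura1998] G. Shimura, *Abelian Varieties with Complex Multiplication and Modular Functions* (1998), §6.1 Corollary, §8.4 Example (1)
  (through `CyclotomicFermatCMTypesPrimePowerIsogenies.isIsogenous_fermatCMType_iff_exists_eq_mul`).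

## Provenance

Cell `pub-hodgecm2` (COR-CM), literature seat `lit-deligne-3` gen 40 (claim KR78-CASE3-FIVE; count-neutral, own lane).  HC_CM is NOT proved
and nothing here bears on it.
-/

namespace Literature.AlgebraicGeometry.ComplexMultiplication

open Literature.AlgebraicGeometry.HodgeTheory (fermatCMType)
open Finset

namespace CyclotomicFermatCMType

/-! ## §0 Elementary helpers (private copies of the siblings') -/

section Helpers

/-- A residue is a unit iff its representative is prime to the modulus. [folklore] -/
private theorem isUnit_iff_val_coprime_ct {m : ℕ} [NeZero m] (x : ZMod m) : IsUnit x ↔ x.val.Coprime m := by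
  conv_lhs => rw [← ZMod.natCast_zmod_val x]
  exact ZMod.isUnit_iff_coprime x.val m

/-- `d ∣ N`, `d ∣ ⟨hx⟩`, `h` a unit ⟹ `d ∣ ⟨x⟩`. [folklore] -/
private theorem dvd_val_of_dvd_val_mul_ct {m d : ℕ} [NeZero m] (hd : d ∣ m) {h : ZMod m} (hh : IsUnit h) {x : ZMod m}
    (hx : d ∣ (h * x).val) : d ∣ x.val := by
  rw [ZMod.val_mul, Nat.dvd_mod_iff hd] at hx
  have hc : Nat.Coprime d h.val := (Nat.Coprime.coprime_dvd_right hd ((isUnit_iff_val_coprime_ct h).1 hh)).symm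
  exact hc.dvd_of_dvd_mul_left hx

/-- `q ∣ N`, `a + b + c = 0`, `q ∣ ⟨a⟩, ⟨b⟩` ⟹ `q ∣ ⟨c⟩`. [folklore] -/
private theorem dvd_val_of_add_eq_zero_ct {m q : ℕ} [NeZero m] (hq : q ∣ m) {a b c : ZMod m} (h : a + b + c = 0)
    (ha : q ∣ a.val) (hb : q ∣ b.val) : q ∣ c.val := by
  have h1 : ((a + b).val + c.val) % m = 0 := by rw [← ZMod.val_add, h, ZMod.val_zero]
  have h2 : q ∣ (a + b).val + c.val := dvd_trans hq (Nat.dvd_of_mod_eq_zero h1)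
  have h3 : q ∣ (a + b).val := by rw [ZMod.val_add, Nat.dvd_mod_iff hq]; exact dvd_add ha hb
  exact (Nat.dvd_add_right h3).1 h2

/-- Every divisor `≠ 1` of a positive `n` prime to `30` is `≥ 7`. [folklore] -/
private theorem seven_le_of_dvd_ct {n m : ℕ} (hn : 0 < n) (hn2 : Nat.Coprime 2 n) (hn3 : Nat.Coprime 3 n) (hn5 : Nat.Coprime 5 n)
    (hm : m ∣ n) (hm1 : m ≠ 1) : 7 ≤ m := by
  have hm0 : m ≠ 0 := fun h => by rw [h, zero_dvd_iff] at hm; omega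
  obtain ⟨q, hq, hqm⟩ := Nat.exists_prime_and_dvd hm1
  have hqn : q ∣ n := dvd_trans hqm hm
  have h2 : q ≠ 2 := fun h => by rw [h] at hqn; exact absurd (Nat.Coprime.eq_one_of_dvd hn2 hqn) (by norm_num)
  have h3 : q ≠ 3 := fun h => by rw [h] at hqn; exact absurd (Nat.Coprime.eq_one_of_dvd hn3 hqn) (by norm_num)
  have h5 : q ≠ 5 := fun h => by rw [h] at hqn; exact absurd (Nat.Coprime.eq_one_of_dvd hn5 hqn) (by norm_num)
  have h4 : q ≠ 4 := fun h => by rw [h] at hq; exact absurd hq (by decide)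
  have h6 : q ≠ 6 := fun h => by rw [h] at hq; exact absurd hq (by decide)
  have := hq.two_le
  have hqm' := Nat.le_of_dvd (Nat.pos_of_ne_zero hm0) hqm
  omega

/-- For `ρ ≢ 0 (mod 5)` and any `j`, some `k < 5` has `5 ∣ j + kρ`. [folklore] -/
private theorem exists_five_dvd_add_mul_ct (j ρ : ℕ) (hρ : ρ % 5 ≠ 0) : ∃ k, k < 5 ∧ 5 ∣ j + k * ρ := by
  have key : ∀ a < 5, ∀ b < 5, b ≠ 0 → ∃ k, k < 5 ∧ (a + k * b) % 5 = 0 := by decide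
  obtain ⟨k, hk, h⟩ := key (j % 5) (Nat.mod_lt j (by norm_num)) (ρ % 5) (Nat.mod_lt ρ (by norm_num)) hρ
  have h1 : j + k * ρ ≡ j % 5 + k * (ρ % 5) [MOD 5] :=
    Nat.ModEq.add (Nat.mod_modEq j 5).symm (Nat.ModEq.mul_left k (Nat.mod_modEq ρ 5).symm)
  exact ⟨k, hk, Nat.modEq_zero_iff_dvd.1 (h1.trans (Nat.modEq_zero_iff_dvd.2 (Nat.dvd_of_mod_eq_zero h)))⟩

/-- `p ∤ ⟨x⟩`, `h` a unit ⟹ `p ∤ ⟨hx⟩` modulo `N = pQ`. [folklore] -/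
private theorem not_dvd_val_mul_ct {p Q : ℕ} [NeZero (p * Q)] (hp : p.Prime) {h : ZMod (p * Q)} (hh : IsUnit h)
    (x : ZMod (p * Q)) (hx : ¬p ∣ x.val) : ¬p ∣ (h * x).val := by
  intro hd
  rw [ZMod.val_mul, Nat.dvd_mod_iff (dvd_mul_right p Q)] at hd
  rcases (Nat.Prime.dvd_mul hp).1 hd with h1 | h1
  · have hc := (isUnit_iff_val_coprime_ct h).1 hh
    exact (Nat.Prime.coprime_iff_not_dvd hp).1 (Nat.Coprime.coprime_dvd_right (dvd_mul_right p Q) hc).symm h1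
  · exact hx h1

/-- `H_{(a,b,c)} = H_{(b,a,c)}`. [cite: KoblitzRohrlich1978, §1 (p. 1184: "`H_{r,s,t}` depends on `{r, s, t}` only up to permutation")] -/
private theorem fermatCMType_swap₁₂_ct {m : ℕ} [NeZero m] (a b c : ZMod m) : fermatCMType m a b c = fermatCMType m b a c := by
  ext x; simp only [fermatCMType, mem_filter, mem_univ, true_and]; constructor <;> rintro ⟨h1, h2⟩ <;> exact ⟨h1, by omega⟩

/-- `H_{(a,b,c)} = H_{(c,b,a)}`. [cite: KoblitzRohrlich1978, §1 (p. 1184)] -/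
private theorem fermatCMType_swap₁₃_ct {m : ℕ} [NeZero m] (a b c : ZMod m) : fermatCMType m a b c = fermatCMType m c b a := by
  ext x; simp only [fermatCMType, mem_filter, mem_univ, true_and]; constructor <;> rintro ⟨h1, h2⟩ <;> exact ⟨h1, by omega⟩

/-- `H_{(a,b,c)} = H_{(a,c,b)}`. [cite: KoblitzRohrlich1978, §1 (p. 1184)] -/
private theorem fermatCMType_swap₂₃_ct {m : ℕ} [NeZero m] (a b c : ZMod m) : fermatCMType m a b c = fermatCMType m a c b := by
  ext x; simp only [fermatCMType, mem_filter, mem_univ, true_and]; constructor <;> rintro ⟨h1, h2⟩ <;> exact ⟨h1, by omega⟩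

/-- Every prime divisor of an `N` prime to `6` is `≥ 5`. [folklore] -/
private theorem five_le_of_prime_dvd_ct {N : ℕ} (hN2 : Nat.Coprime 2 N) (hN3 : Nat.Coprime 3 N) {p : ℕ} (hp : p.Prime) (hpN : p ∣ N) :
    5 ≤ p := by
  have h2 : p ≠ 2 := fun h => by rw [h] at hpN; exact absurd (Nat.Coprime.eq_one_of_dvd hN2 hpN) (by norm_num)
  have h3 : p ≠ 3 := fun h => by rw [h] at hpN; exact absurd (Nat.Coprime.eq_one_of_dvd hN3 hpN) (by norm_num)
  have h4 : p ≠ 4 := fun h => by rw [h] at hp; exact absurd hp (by decide)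
  have := hp.two_le
  omega

/-- A prime `≥ 5` other than `5` and `7` is `≥ 11`. [folklore] -/
private theorem eleven_le_of_ne_ct {q : ℕ} (hq : q.Prime) (hq5 : 5 ≤ q) (hne5 : q ≠ 5) (hne7 : q ≠ 7) : 11 ≤ q := by
  have h6 : q ≠ 6 := fun h => by rw [h] at hq; exact absurd hq (by decide)
  have h8 : q ≠ 8 := fun h => by rw [h] at hq; exact absurd hq (by decide)
  have h9 : q ≠ 9 := fun h => by rw [h] at hq; exact absurd hq (by decide)
  have h10 : q ≠ 10 := fun h => by rw [h] at hq; exact absurd hq (by decide)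
  omega

/-- `p`-divisibility of representatives is invariant under unit multiples (`p ∣ N`). [folklore] -/
private theorem dvd_val_mul_iff_of_isUnit_ct {N : ℕ} [NeZero N] {p : ℕ} (hpN : p ∣ N) {u : ZMod N} (hu : IsUnit u) (x : ZMod N) :
    p ∣ (u * x).val ↔ p ∣ x.val := by
  refine ⟨dvd_val_of_dvd_val_mul_ct hpN hu, fun h => ?_⟩
  rw [ZMod.val_mul]
  exact (Nat.dvd_mod_iff hpN).2 (dvd_mul_of_dvd_right h _)

/-- `r ≠ 0` with `p ∣ ⟨r⟩` modulo `N = pQ` forces `Q ≥ 2`. [folklore] -/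
private theorem two_le_of_dvd_val_ct {p Q : ℕ} [NeZero (p * Q)] {r : ZMod (p * Q)} (hr : r ≠ 0) (hpr : p ∣ r.val) : 2 ≤ Q := by
  have h0 : 0 < r.val := Nat.pos_of_ne_zero fun h => hr ((ZMod.val_eq_zero r).1 h)
  have h1 := Nat.le_of_dvd h0 hpr
  have h2 := ZMod.val_lt r
  by_contra hQ
  push Not at hQ
  interval_cases Q <;> omega

/-- The residues `r₀ + s₀ + t₀` of a primitive admissible triple at a unit `u` (`x₀ = ⟨ux⟩ mod Q`, `N = pQ`, `Q ≥ 2`) add up to `Q` or `2Q`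
("`r₀′ + s₀′ + t₀′ = N/p` or `2N/p`", p. 1194; `= 0` is excluded by primitivity: `Q` would divide `⟨r⟩, ⟨s⟩, ⟨t⟩`).
[cite: KoblitzRohrlich1978, §3 Case 1 (p. 1194) and Case 2 (p. 1195, (5)–(6))] -/
private theorem exists_residue_sum_eq_ct {p Q : ℕ} [NeZero (p * Q)] {r s t : ZMod (p * Q)} (hrst : r + s + t = 0)
    (hprim : ∀ q : ℕ, q.Prime → q ∣ p * Q → ¬(q ∣ r.val ∧ q ∣ s.val ∧ q ∣ t.val)) (hQ2 : 2 ≤ Q) {u : ZMod (p * Q)}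
    (hu : IsUnit u) : ∃ k, 1 ≤ k ∧ k ≤ 2 ∧ (u * r).val % Q + (u * s).val % Q + (u * t).val % Q = Q * k := by
  have hQ0 : 0 < Q := by omega
  have hQN : Q ∣ p * Q := dvd_mul_left Q p
  have hsum : u * r + u * s + u * t = 0 := by rw [← mul_add, ← mul_add, hrst, mul_zero]
  -- `Q ∣ ⟨ur⟩ + ⟨us⟩ + ⟨ut⟩`
  have h3 : Q ∣ (u * r).val + (u * s).val + (u * t).val := by
    have h1 : ((u * r + u * s).val + (u * t).val) % (p * Q) = 0 := by rw [← ZMod.val_add, hsum, ZMod.val_zero]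
    have h2 : Q ∣ (u * r + u * s).val + (u * t).val := dvd_trans hQN (Nat.dvd_of_mod_eq_zero h1)
    rw [ZMod.val_add] at h2
    have h4 := Nat.mod_add_div ((u * r).val + (u * s).val) (p * Q)
    have h5 : (u * r).val + (u * s).val + (u * t).val =
        ((u * r).val + (u * s).val) % (p * Q) + (u * t).val + (p * Q) * (((u * r).val + (u * s).val) / (p * Q)) := by omega
    rw [h5]
    exact dvd_add h2 (dvd_mul_of_dvd_left hQN _)
  -- hence `Q ∣ r₀ + s₀ + t₀`
  have h4 : Q ∣ (u * r).val % Q + (u * s).val % Q + (u * t).val % Q :=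
    (Nat.modEq_zero_iff_dvd).1 ((((Nat.mod_modEq _ Q).add (Nat.mod_modEq _ Q)).add (Nat.mod_modEq _ Q)).trans
      ((Nat.modEq_zero_iff_dvd).2 h3))
  obtain ⟨k, hk⟩ := h4
  have hr₀ := Nat.mod_lt (u * r).val hQ0
  have hs₀ := Nat.mod_lt (u * s).val hQ0
  have ht₀ := Nat.mod_lt (u * t).val hQ0
  have hk2 : k ≤ 2 := by
    by_contra h
    have : Q * 3 ≤ Q * k := Nat.mul_le_mul_left Q (by omega)
    omega
  have hk1 : 1 ≤ k := by
    by_contra h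
    have hk0 : k = 0 := by omega
    rw [hk0, mul_zero] at hk
    have hQr : Q ∣ r.val := dvd_val_of_dvd_val_mul_ct hQN hu (Nat.dvd_of_mod_eq_zero (by omega))
    have hQs : Q ∣ s.val := dvd_val_of_dvd_val_mul_ct hQN hu (Nat.dvd_of_mod_eq_zero (by omega))
    have hQt : Q ∣ t.val := dvd_val_of_dvd_val_mul_ct hQN hu (Nat.dvd_of_mod_eq_zero (by omega))
    obtain ⟨q, hq, hqQ⟩ := Nat.exists_prime_and_dvd (by omega : Q ≠ 1)
    exact hprim q hq (dvd_trans hqQ hQN) ⟨dvd_trans hqQ hQr, dvd_trans hqQ hQs, dvd_trans hqQ hQt⟩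
  exact ⟨k, hk1, hk2, hk⟩

/-- Membership in `H_{(a,b,c)}` (unfolding the tree's `fermatCMType`). [cite: KoblitzRohrlich1978, §1 (p. 1184)] -/
private theorem mem_fermatCMType_iff_ct {m : ℕ} [NeZero m] (a b c x : ZMod m) :
    x ∈ fermatCMType m a b c ↔ x.val.Coprime m ∧ (x * a).val + (x * b).val + (x * c).val = m := by
  simp only [fermatCMType, mem_filter, mem_univ, true_and]

/-- For a triple with `a + b + c = 0` and any multiplier `h`: `⟨ha⟩ + ⟨hb⟩ + ⟨hc⟩ = k·m`, `k ≤ 2`. [cite: KoblitzRohrlich1978, §1 (p. 1184)] -/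
private theorem exists_val_sum_eq_mul_ct {m : ℕ} [NeZero m] {a b c : ZMod m} (habc : a + b + c = 0) (h : ZMod m) :
    ∃ k, k ≤ 2 ∧ (h * a).val + (h * b).val + (h * c).val = k * m := by
  have hsum0 : (((h * a).val + (h * b).val + (h * c).val : ℕ) : ZMod m) = 0 := by
    push_cast
    rw [ZMod.natCast_zmod_val, ZMod.natCast_zmod_val, ZMod.natCast_zmod_val, ← mul_add, ← mul_add, habc, mul_zero]
  obtain ⟨k, hk⟩ := (ZMod.natCast_eq_zero_iff _ _).mp hsum0
  have hxlt := ZMod.val_lt (h * a)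
  have hylt := ZMod.val_lt (h * b)
  have hzlt := ZMod.val_lt (h * c)
  refine ⟨k, ?_, by rw [hk, mul_comm]⟩
  by_contra hk3
  push Not at hk3
  have := Nat.mul_le_mul_left m hk3
  omega

/-- `H_{uτ} = H_{uτ′}` from `H_τ = H_{τ′}` for a unit `u` (`H_{uτ} = u⁻¹H_τ`, tree `mem_fermatCMType_mul_iff_of_isUnit`).
[cite: KoblitzRohrlich1978, §1 (p. 1184)] -/
private theorem fermatCMType_mul_eq_ct {m : ℕ} [NeZero m] {u : ZMod m} (hu : IsUnit u) {a b c a' b' c' : ZMod m}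
    (h : fermatCMType m a b c = fermatCMType m a' b' c') :
    fermatCMType m (u * a) (u * b) (u * c) = fermatCMType m (u * a') (u * b') (u * c') := by
  ext x
  rw [mem_fermatCMType_mul_iff_of_isUnit hu, mem_fermatCMType_mul_iff_of_isUnit hu, h]

/-- The unit `u = 1 + iN₀ ∈ P` with `⟨us⟩ = N − a` ("Multiplying through by a suitable `u ∈ P*`, without loss of generality we may assume that
`τ = (5, N − a, N − b)`", p. 1196; `u` is a unit because `5 ∤ a`). [cite: KoblitzRohrlich1978, §3 Proposition, Case 2 at `p = 5` (p. 1196)] -/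
private theorem exists_unit_P_ct {Q : ℕ} [NeZero (5 * Q)] (hQ1 : 1 < Q) {s : ZMod (5 * Q)} (h5s : ¬5 ∣ s.val) {a : ℕ} (ha : s.val % Q + a = Q) (ha1 : 1 ≤ a)
    (ha4 : a ≤ 4) : ∃ (i : ℕ) (u : ZMod (5 * Q)), u = 1 + (i : ZMod (5 * Q)) * (Q : ZMod (5 * Q)) ∧ IsUnit u ∧ (u * s).val = 5 * Q - a := by
  have h5 : (5 : ℕ).Prime := by norm_num
  have hρ : s.val % 5 ≠ 0 := fun h => h5s (Nat.dvd_of_mod_eq_zero h)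
  obtain ⟨i, hi5, hi⟩ := exists_five_dvd_add_mul_ct (s.val / Q + 1) s.val hρ
  set u : ZMod (5 * Q) := 1 + (i : ZMod (5 * Q)) * (Q : ZMod (5 * Q)) with hudef
  have hus : (u * s).val = 5 * Q - a := by
    have h1 := val_orbit_mul_eq (p := 5) (by norm_num) 1 s i
    rw [one_mul, one_mul] at h1
    rw [h1]
    have h2 : (s.val / Q + i * s.val) % 5 = 4 := by omega
    rw [h2]
    omega
  have hucast : u = ((1 + i * Q : ℕ) : ZMod (5 * Q)) := by rw [hudef]; push_cast; ring
  have huval : u.val = 1 + i * Q := by rw [hucast, ZMod.val_natCast, Nat.mod_eq_of_lt (by nlinarith)]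
  refine ⟨i, u, rfl, ?_, hus⟩
  rw [hucast, ZMod.isUnit_iff_coprime]
  refine Nat.Coprime.mul_right ?_ ?_
  · -- `5 ∤ 1 + iQ`: otherwise `5 ∣ ⟨us⟩ = N − a`
    refine ((Nat.Prime.coprime_iff_not_dvd h5).2 fun hd => ?_).symm
    have h1 : 5 ∣ (u * s).val := by
      rw [ZMod.val_mul, huval, Nat.dvd_mod_iff (dvd_mul_right 5 Q)]
      exact dvd_mul_of_dvd_left hd _
    rw [hus] at h1
    omega
  · rw [Nat.coprime_add_mul_right_left]; exact Nat.coprime_one_left Q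

/-- With `⟨r⟩ = 5`, `⟨x⟩ = N − a` and `r + x + z = 0`: `⟨z⟩ = N − b`, `b = 5 − a`. [folklore] -/
private theorem val_third_ct {Q : ℕ} [NeZero (5 * Q)] (hQ1 : 1 < Q) {r x z : ZMod (5 * Q)} (h : r + x + z = 0) (hr5 : r.val = 5) {a : ℕ} (hx : x.val = 5 * Q - a)
    (ha1 : 1 ≤ a) (ha4 : a ≤ 4) : z.val = 5 * Q - (5 - a) := by
  have e : z = -(r + x) := by rw [← add_eq_zero_iff_eq_neg.1]; rw [show z + (r + x) = r + x + z by ring, h]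
  have h1 : (r + x).val = 5 - a := by
    have := ZMod.val_add_val_of_le (a := r) (b := x) (by rw [hr5, hx]; omega)
    rw [hr5, hx] at this
    omega
  have hne0 : r + x ≠ 0 := fun h0 => by rw [h0, ZMod.val_zero] at h1; omega
  rw [e, ZMod.neg_val, if_neg hne0, h1]

end Helpers

/-! ## §1 CASE 3 AT `p = 5`, `5 ∥ N`, SETTLED: everything K–R print (p. 1197) — the reduction to `τ = (5, N − a, N − b)` with `r₀′ + s₀′ +
t₀′ = N/5` and the explicit criterion (10) — and, in place of the omitted "tedious examination", the orbit of `h₀ = N/5 − 5` (`N/5 > 20`)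
and kernel searches at `N ∈ {35, 55, 65, 85, 95}` -/

section CaseThreeFive

variable {p Q : ℕ} [NeZero (p * Q)]

/-- **The orbit-sum relation of Case 3** ("`νN ≥ Σ_{u∈P} ⟨ur⟩ + ⟨us⟩ + ⟨ut⟩ − Σ_{u∈P} ⟨ur′⟩ + ⟨us′⟩ + ⟨ut′⟩ = pr + Σ_{i} (s₀ + iN/p + t₀ + iN/p −
r₀′ − iN/p − s₀′ − iN/p − t₀′ − iN/p)`", p. 1196, kept exact): `p ∣ ⟨r⟩`, `p ∤ ⟨r′⟩, ⟨s′⟩, ⟨t′⟩`; for every unit `u` there are `k, k′ ∈ {1, 2}`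
(residue sums `kQ`, `k′Q`) and `E, E′` with `2N(⌊⟨ur⟩/Q⌋ + k) + 2E′ = 2Nk′ + Q·p(p−1) + 2E`.
[cite: KoblitzRohrlich1978, §3 Proposition, Case 3 (pp. 1196–1197, (8))] -/
private theorem relation_three_ct (hp : p.Prime) {r s t r' s' t' : ZMod (p * Q)} (hr : r ≠ 0) (hrst : r + s + t = 0) (hr' : r' ≠ 0)
    (hrst' : r' + s' + t' = 0) (hprim : ∀ q : ℕ, q.Prime → q ∣ p * Q → ¬(q ∣ r.val ∧ q ∣ s.val ∧ q ∣ t.val))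
    (hprim' : ∀ q : ℕ, q.Prime → q ∣ p * Q → ¬(q ∣ r'.val ∧ q ∣ s'.val ∧ q ∣ t'.val)) (hpr : p ∣ r.val) (hpr' : ¬p ∣ r'.val)
    (hps' : ¬p ∣ s'.val) (hpt' : ¬p ∣ t'.val) (hEq : fermatCMType (p * Q) r s t = fermatCMType (p * Q) r' s' t') {u : ZMod (p * Q)}
    (hu : IsUnit u) :
    ∃ k k' E E' : ℕ, (1 ≤ k ∧ k ≤ 2) ∧ (1 ≤ k' ∧ k' ≤ 2) ∧
      (u * r).val % Q + (u * s).val % Q + (u * t).val % Q = Q * k ∧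
      (u * r').val % Q + (u * s').val % Q + (u * t').val % Q = Q * k' ∧
      2 * (p * Q) * ((u * r).val / Q + k) + 2 * E' = 2 * (p * Q) * k' + Q * (p * (p - 1)) + 2 * E ∧
      ((E = 0 ∧ E' = 0) ∨ (p * Q ≤ E ∧ E ≤ 2 * (p * Q) ∧ p * Q ≤ E' ∧ E' ≤ 2 * (p * Q))) := by
  have hQ2 : 2 ≤ Q := two_le_of_dvd_val_ct hr hpr
  have hps : ¬p ∣ s.val := fun h => hprim p hp (dvd_mul_right p Q) ⟨hpr, h, (dvd_val_iff_of_add_eq_zero hrst hpr).1 h⟩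
  have hpt : ¬p ∣ t.val := fun h => hps ((dvd_val_iff_of_add_eq_zero hrst hpr).2 h)
  obtain ⟨E, E', hcmp, hE, -⟩ := orbit_sum_compare hp hr hrst hr' hrst' hprim hprim' hEq hu
  simp only [sum_add_distrib] at hcmp
  have hTr := sum_val_orbit_mul_of_dvd u r hpr
  have hTs := two_mul_sum_val_orbit_mul hp u s (not_dvd_val_mul_ct hp hu s hps)
  have hTt := two_mul_sum_val_orbit_mul hp u t (not_dvd_val_mul_ct hp hu t hpt)
  have hTr' := two_mul_sum_val_orbit_mul hp u r' (not_dvd_val_mul_ct hp hu r' hpr')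
  have hTs' := two_mul_sum_val_orbit_mul hp u s' (not_dvd_val_mul_ct hp hu s' hps')
  have hTt' := two_mul_sum_val_orbit_mul hp u t' (not_dvd_val_mul_ct hp hu t' hpt')
  obtain ⟨k, hk1, hk2, hk⟩ := exists_residue_sum_eq_ct hrst hprim hQ2 hu
  obtain ⟨k', hk1', hk2', hk'⟩ := exists_residue_sum_eq_ct hrst' hprim' hQ2 hu
  have hRp : p * (u * r).val = p * Q * ((u * r).val / Q) + p * ((u * r).val % Q) := by
    conv_lhs => rw [← Nat.div_add_mod (u * r).val Q]
    rw [Nat.mul_add, ← mul_assoc]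
  have hkp : p * ((u * r).val % Q) + p * ((u * s).val % Q) + p * ((u * t).val % Q) = p * Q * k := by
    rw [← Nat.mul_add, ← Nat.mul_add, hk, mul_assoc]
  have hkp' : p * ((u * r').val % Q) + p * ((u * s').val % Q) + p * ((u * t').val % Q) = p * Q * k' := by
    rw [← Nat.mul_add, ← Nat.mul_add, hk', mul_assoc]
  refine ⟨k, k', E, E', ⟨hk1, hk2⟩, ⟨hk1', hk2'⟩, hk, hk', by linarith, hE⟩

variable {Q' : ℕ} [NeZero (5 * Q')]

/-- **Case 3 at `p = 5`, `5 ∥ N`: the equality case of (8)** ("By (8), `N/5 ≥ 2N/5 + r₀′ + s₀′ + t₀′ − (5 + s₀ + t₀)`, which is only possible if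
`r₀′ + s₀′ + t₀′ = N/5`, `5 + s₀ + t₀ = 2N/5`", p. 1197): at `N = 5Q`, `Q > 5`, with `⟨r⟩ = 5` and `5 ∤ ⟨r′⟩, ⟨s′⟩, ⟨t′⟩`: `s₀ + t₀ = 2Q − 5` and
`r₀′ + s₀′ + t₀′ = Q`. [cite: KoblitzRohrlich1978, §3 Proposition, Case 3 at `p = 5` (p. 1197)] -/
private theorem residues_three_ct (hQ5 : 5 < Q') {r s t r' s' t' : ZMod (5 * Q')} (hr : r ≠ 0) (hrst : r + s + t = 0)
    (hr' : r' ≠ 0) (hrst' : r' + s' + t' = 0) (hprim : ∀ q : ℕ, q.Prime → q ∣ 5 * Q' → ¬(q ∣ r.val ∧ q ∣ s.val ∧ q ∣ t.val))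
    (hprim' : ∀ q : ℕ, q.Prime → q ∣ 5 * Q' → ¬(q ∣ r'.val ∧ q ∣ s'.val ∧ q ∣ t'.val))
    (hEq : fermatCMType (5 * Q') r s t = fermatCMType (5 * Q') r' s' t') (hr5 : r.val = 5) (h5r' : ¬5 ∣ r'.val)
    (h5s' : ¬5 ∣ s'.val) (h5t' : ¬5 ∣ t'.val) : s.val % Q' + t.val % Q' = 2 * Q' - 5 ∧ r'.val % Q' + s'.val % Q' + t'.val % Q' = Q' := by
  have h5 : (5 : ℕ).Prime := by norm_num
  obtain ⟨k, k', E, E', ⟨hk1, hk2⟩, ⟨hk1', hk2'⟩, hk, hk', hrel, hE⟩ :=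
    relation_three_ct (p := 5) h5 hr hrst hr' hrst' hprim hprim' (by rw [hr5]) h5r' h5s' h5t' hEq isUnit_one
  simp only [one_mul] at hk hk' hrel
  have hD : r.val / Q' = 0 := Nat.div_eq_of_lt (by omega)
  rw [hD, show Q' * (5 * (5 - 1)) = 4 * (5 * Q') by norm_num; ring] at hrel
  have hr₀ : r.val % Q' = 5 := by rw [hr5]; exact Nat.mod_eq_of_lt hQ5
  have hkk : k = 2 ∧ k' = 1 := by
    rcases hE with ⟨rfl, rfl⟩ | ⟨hE1, hE2, hE1', hE2'⟩
    · interval_cases k <;> interval_cases k' <;> omega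
    · interval_cases k <;> interval_cases k' <;> omega
  obtain ⟨rfl, rfl⟩ := hkk
  constructor <;> omega

/-- One side of the reduction: in Case 3 at `p = 5` (`5 ∣ ⟨r⟩`, `5 ∤ ⟨r′⟩, ⟨s′⟩, ⟨t′⟩`), g.c.d.`(⟨r⟩, N) = 5` ("If `r > 5`, there is a prime
`q > 5` dividing `r` and `N`, and we can use Case 1, 2, or 3 with `p = q > 5`. So suppose `r = 5`", p. 1197).
[cite: KoblitzRohrlich1978, §3 Proposition, Case 3 at `p = 5` (p. 1197)] -/
private theorem gcd_eq_five_three_ct {N : ℕ} [NeZero N] (hN2 : Nat.Coprime 2 N) (hN3 : Nat.Coprime 3 N) (h5N : 5 ∣ N)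
    (h25 : ¬5 * 5 ∣ N) {r s t r' s' t' : ZMod N} (hr : r ≠ 0) (hs : s ≠ 0) (ht : t ≠ 0) (hrst : r + s + t = 0)
    (hr' : r' ≠ 0) (hs' : s' ≠ 0) (ht' : t' ≠ 0) (hrst' : r' + s' + t' = 0)
    (hprim : ∀ q : ℕ, q.Prime → q ∣ N → ¬(q ∣ r.val ∧ q ∣ s.val ∧ q ∣ t.val))
    (hprim' : ∀ q : ℕ, q.Prime → q ∣ N → ¬(q ∣ r'.val ∧ q ∣ s'.val ∧ q ∣ t'.val))
    (h5r : 5 ∣ r.val) (h5r' : ¬5 ∣ r'.val) (h5s' : ¬5 ∣ s'.val) (h5t' : ¬5 ∣ t'.val)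
    (hEq : fermatCMType N r s t = fermatCMType N r' s' t') : Nat.gcd r.val N = 5 := by
  have hq : ∀ q : ℕ, q.Prime → q ∣ Nat.gcd r.val N → q = 5 := by
    intro q hq hqg
    by_contra hq5
    have hqN : q ∣ N := dvd_trans hqg (Nat.gcd_dvd_right _ _)
    have hq5' : 5 ≤ q := five_le_of_prime_dvd_ct hN2 hN3 hq hqN
    have hq6 : q ≠ 6 := fun h => by rw [h] at hq; exact absurd hq (by decide)
    rcases eq_or_eq_or_eq_of_fermatCMType_eq_of_dvd_of_seven_le hN2 hN3 hq (by omega) hqN hr hs ht hrst hr' hs' ht' hrst' hprim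
        hprim' (dvd_trans hqg (Nat.gcd_dvd_left _ _)) hEq with h | h | h
    · exact h5r' (h ▸ h5r)
    · exact h5s' (h ▸ h5r)
    · exact h5t' (h ▸ h5r)
  obtain ⟨m, hm⟩ := Nat.dvd_gcd h5r h5N
  have hm1 : m = 1 := by
    refine Nat.eq_one_iff_not_exists_prime_dvd.2 fun q hq' hqm => ?_
    have hqg : q ∣ Nat.gcd r.val N := by rw [hm]; exact dvd_mul_of_dvd_right hqm 5
    have := hq q hq' hqg
    subst this
    exact h25 (dvd_trans (by rw [hm]; exact Nat.mul_dvd_mul_left 5 hqm) (Nat.gcd_dvd_right r.val N))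
  rw [hm, hm1]

/-- **K–R's criterion (10)** ("But for this `τ` we know `H_τ ⊂ (ℤ/Nℤ)*` explicitly. Namely, if `h ∈ (ℤ/Nℤ)*`, then (10) `h ∈ H_τ ⟺ [5⟨h⟩/N] +
[a⟨h⟩/N] + [b⟨h⟩/N]` is odd", p. 1197): for `τ = (r, x, z)` modulo `N = 5Q` prime to `6` (`Q ≥ 2`) with `⟨r⟩ = 5`, `⟨x⟩ = N − a`, `⟨z⟩ = N −
b`, `a + b = 5`, `a, b ≥ 1`, a residue `h` lies in `H_τ` iff `h` is a unit and `⌊5⟨h⟩/N⌋ + ⌊a⟨h⟩/N⌋ + ⌊b⟨h⟩/N⌋` is odd (`⟨hx⟩ = N − ⟨ah⟩`, `⟨hz⟩ =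
N − ⟨bh⟩`, and `⌊5y⌋ − ⌊ay⌋ − ⌊by⌋ ∈ {0, 1}`). [cite: KoblitzRohrlich1978, §3 Proposition, Case 3 at `p = 5`, (10) (p. 1197)] -/
theorem mem_fermatCMType_five_iff (hN2 : Nat.Coprime 2 (5 * Q')) (hN3 : Nat.Coprime 3 (5 * Q')) (hQ2 : 2 ≤ Q') {r x z : ZMod (5 * Q')}
    (hr5 : r.val = 5) {a : ℕ} (hx : x.val = 5 * Q' - a) (hz : z.val = 5 * Q' - (5 - a)) (ha1 : 1 ≤ a) (ha4 : a ≤ 4) (h : ZMod (5 * Q')) :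
    h ∈ fermatCMType (5 * Q') r x z ↔
      IsUnit h ∧ (5 * h.val / (5 * Q') + a * h.val / (5 * Q') + (5 - a) * h.val / (5 * Q')) % 2 = 1 := by
  rw [mem_fermatCMType_iff_ct, ← isUnit_iff_val_coprime_ct]
  refine and_congr_right fun hu => ?_
  have hN0 : 0 < 5 * Q' := by omega
  have h5Q : Nat.Coprime 5 (5 * Q') → False := fun h => by
    have := Nat.Coprime.eq_one_of_dvd h (dvd_mul_right 5 Q'); omega
  -- `c ∈ {1, …, 4}` is a unit modulo `N`
  have hcu : ∀ {c : ℕ}, 1 ≤ c → c ≤ 4 → IsUnit ((c : ℕ) : ZMod (5 * Q')) := fun {c} hc1 hc4 => by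
    rw [ZMod.isUnit_iff_coprime]
    interval_cases c
    · exact Nat.coprime_one_left _
    · exact hN2
    · exact hN3
    · exact (show (4 : ℕ) = 2 * 2 by norm_num) ▸ Nat.Coprime.mul_left hN2 hN2
  -- `⟨h·(−c)⟩ = N − (c⟨h⟩ mod N)` with `c⟨h⟩ mod N > 0`
  have hneg : ∀ {y : ZMod (5 * Q')} {c : ℕ}, 1 ≤ c → c ≤ 4 → y.val = 5 * Q' - c →
      (h * y).val + c * h.val % (5 * Q') = 5 * Q' ∧ 0 < c * h.val % (5 * Q') := by
    intro y c hc1 hc4 hy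
    have hyc : y = -((c : ℕ) : ZMod (5 * Q')) := by
      rw [← ZMod.natCast_zmod_val y, hy, Nat.cast_sub (by omega), ZMod.natCast_self, zero_sub]
    have hw : IsUnit (((c : ℕ) : ZMod (5 * Q')) * h) := (hcu hc1 hc4).mul hu
    haveI : Nontrivial (ZMod (5 * Q')) := ZMod.nontrivial_iff.2 (by omega)
    have hw0 : ((c : ℕ) : ZMod (5 * Q')) * h ≠ 0 := hw.ne_zero
    have hwv : (((c : ℕ) : ZMod (5 * Q')) * h).val = c * h.val % (5 * Q') := by
      rw [ZMod.val_mul, ZMod.val_natCast, Nat.mod_eq_of_lt (by omega : c < 5 * Q')]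
    have hpos : 0 < c * h.val % (5 * Q') := Nat.pos_of_ne_zero fun h0 => hw0 ((ZMod.val_eq_zero _).1 (by rw [hwv, h0]))
    have e : h * y = -(((c : ℕ) : ZMod (5 * Q')) * h) := by rw [hyc]; ring
    rw [e, ZMod.neg_val, if_neg hw0, hwv]
    have := Nat.mod_lt (c * h.val) hN0
    omega
  obtain ⟨hxa, hρa⟩ := hneg ha1 ha4 hx
  obtain ⟨hzb, hρb⟩ := hneg (c := 5 - a) (by omega) (by omega) hz
  have hr' : (h * r).val = 5 * h.val % (5 * Q') := by
    rw [ZMod.val_mul, hr5, mul_comm]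
  -- `5⟨h⟩ = a⟨h⟩ + b⟨h⟩`: the digit relation `D₅ ∈ {D_a + D_b, D_a + D_b + 1}`
  have e5 := Nat.div_add_mod (5 * h.val) (5 * Q')
  have ea := Nat.div_add_mod (a * h.val) (5 * Q')
  have eb := Nat.div_add_mod ((5 - a) * h.val) (5 * Q')
  have hsplit : 5 * h.val = a * h.val + (5 - a) * h.val := by
    rw [← Nat.add_mul]; congr 1; omega
  have hρ5 := Nat.mod_lt (5 * h.val) hN0
  have hρa' := Nat.mod_lt (a * h.val) hN0
  have hρb' := Nat.mod_lt ((5 - a) * h.val) hN0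
  set D5 := 5 * h.val / (5 * Q')
  set Da := a * h.val / (5 * Q')
  set Db := (5 - a) * h.val / (5 * Q')
  have hlo : Da + Db ≤ D5 := by
    by_contra hc
    have h1 : 5 * Q' * (D5 + 1) ≤ 5 * Q' * (Da + Db) := Nat.mul_le_mul_left (5 * Q') (by omega)
    rw [Nat.mul_add, Nat.mul_add, mul_one] at h1
    omega
  have hhi : D5 ≤ Da + Db + 1 := by
    by_contra hc
    have h1 : 5 * Q' * (Da + Db + 2) ≤ 5 * Q' * D5 := Nat.mul_le_mul_left (5 * Q') (by omega)
    rw [Nat.mul_add, Nat.mul_add] at h1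
    omega
  have hND : 5 * Q' * (Da + Db) = 5 * Q' * Da + 5 * Q' * Db := Nat.mul_add (5 * Q') Da Db
  rcases Nat.eq_or_lt_of_le hlo with heq | hlt
  · -- `D₅ = D_a + D_b`: `⟨5h⟩ = ⟨ah⟩ + ⟨bh⟩`, the sum is `2N`, the digit sum is even
    rw [← heq]
    constructor
    · intro hsum; exfalso; rw [← heq, hND] at e5; omega
    · intro hodd; exfalso; omega
  · have heq : D5 = Da + Db + 1 := by omega
    rw [heq]
    constructor
    · intro _; omega
    · intro _; rw [heq, Nat.mul_add, hND, mul_one] at e5; omega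

/-- **CASE 3 AT `p = 5`, `5 ∥ N`: K–R's PRINTED REDUCTION** ("We now consider the case `p = 5`, `5² ∤ N`. If `r > 5`, there is a prime `q > 5`
dividing `r` and `N`, and we can use Case 1, 2, or 3 with `p = q > 5`. So suppose `r = 5`. By (8) … which is only possible if `r₀′ + s₀′ + t₀′ =
N/5`, `5 + s₀ + t₀ = 2N/5`. Thus, `τ = (5, iN/5 − a, jN/5 − b)`, where `a, b > 0`, `a + b = 5`. Multiplying through by a suitable element in `P*`,
without loss of generality we may assume that `τ = (5, N − a, N − b)`", p. 1197): at `N = 5Q` prime to `6` with `5 ∤ Q`, for admissible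
primitive `τ, τ′` with `H_τ = H_{τ′}`, `5 ∣ ⟨r⟩` and `5 ∤ ⟨r′⟩, ⟨s′⟩, ⟨t′⟩`, there are a UNIT `u` and `a ∈ {1, 2, 3, 4}` with `uτ = (5, N − a,
N − (5 − a))` on representatives, `H_{uτ} = H_{uτ′}`, `5 ∤ ⟨ur′⟩, ⟨us′⟩, ⟨ut′⟩`, and `⟨ur′⟩₀ + ⟨us′⟩₀ + ⟨ut′⟩₀ = N/5` (residues modulo `N/5`).
K–R's conclusion that no such `τ′` exists ("By a tedious examination … omitted", with (10) = `mem_fermatCMType_five_iff`) has no printed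
proof; it is settled below (`fermatCMType_ne_of_five_dvd_of_not_dvd`) by a different road. [cite: KoblitzRohrlich1978, §3 Proposition, Case 3 at `p = 5` (p. 1197)] -/
theorem case_three_five_reduction (hN2 : Nat.Coprime 2 (5 * Q')) (hN3 : Nat.Coprime 3 (5 * Q')) (h5Q : ¬5 ∣ Q')
    {r s t r' s' t' : ZMod (5 * Q')} (hr : r ≠ 0) (hs : s ≠ 0) (ht : t ≠ 0) (hrst : r + s + t = 0)
    (hr' : r' ≠ 0) (hs' : s' ≠ 0) (ht' : t' ≠ 0) (hrst' : r' + s' + t' = 0)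
    (hprim : ∀ q : ℕ, q.Prime → q ∣ 5 * Q' → ¬(q ∣ r.val ∧ q ∣ s.val ∧ q ∣ t.val))
    (hprim' : ∀ q : ℕ, q.Prime → q ∣ 5 * Q' → ¬(q ∣ r'.val ∧ q ∣ s'.val ∧ q ∣ t'.val))
    (h5r : 5 ∣ r.val) (h5r' : ¬5 ∣ r'.val) (h5s' : ¬5 ∣ s'.val) (h5t' : ¬5 ∣ t'.val)
    (hEq : fermatCMType (5 * Q') r s t = fermatCMType (5 * Q') r' s' t') :
    ∃ (u : ZMod (5 * Q')) (a : ℕ), IsUnit u ∧ 1 ≤ a ∧ a ≤ 4 ∧ (u * r).val = 5 ∧ (u * s).val = 5 * Q' - a ∧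
      (u * t).val = 5 * Q' - (5 - a) ∧ fermatCMType (5 * Q') (u * r) (u * s) (u * t) = fermatCMType (5 * Q') (u * r') (u * s') (u * t') ∧
      ¬5 ∣ (u * r').val ∧ ¬5 ∣ (u * s').val ∧ ¬5 ∣ (u * t').val ∧ (u * r').val % Q' + (u * s').val % Q' + (u * t').val % Q' = Q' := by
  have h5 : (5 : ℕ).Prime := by norm_num
  have hN0 : 0 < 5 * Q' := Nat.pos_of_ne_zero (NeZero.ne _)
  have hQ0 : 0 < Q' := by omega
  have hQ2 : Nat.Coprime 2 Q' := Nat.Coprime.coprime_dvd_right (dvd_mul_left Q' 5) hN2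
  have hQ3 : Nat.Coprime 3 Q' := Nat.Coprime.coprime_dvd_right (dvd_mul_left Q' 5) hN3
  have hQ5 : Nat.Coprime 5 Q' := (Nat.Prime.coprime_iff_not_dvd h5).2 h5Q
  have hQ1 : Q' ≠ 1 := fun h => by
    have h1 : r.val < 5 * Q' := ZMod.val_lt r
    have h2 : 0 < r.val := Nat.pos_of_ne_zero fun h0 => hr ((ZMod.val_eq_zero r).1 h0)
    have h3 := Nat.le_of_dvd h2 h5r
    omega
  have hQ7 : 7 ≤ Q' := seven_le_of_dvd_ct hQ0 hQ2 hQ3 hQ5 (dvd_refl Q') hQ1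
  have h25 : ¬5 * 5 ∣ 5 * Q' := fun h => h5Q ((Nat.mul_dvd_mul_iff_left (by norm_num : 0 < 5)).1 h)
  -- `g.c.d.(N, r) = 5`; normalise `⟨u₀r⟩ = 5`
  have hg := gcd_eq_five_three_ct hN2 hN3 (dvd_mul_right 5 Q') h25 hr hs ht hrst hr' hs' ht' hrst' hprim hprim' h5r h5r' h5s' h5t' hEq
  obtain ⟨u₀, hu₀, hu₀r⟩ := exists_isUnit_val_mul_eq_gcd hr
  rw [hg] at hu₀r
  have hne₀ : ∀ {x : ZMod (5 * Q')}, x ≠ 0 → u₀ * x ≠ 0 := fun hx h => hx (hu₀.mul_right_eq_zero.1 h)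
  have hdv₀ : ∀ {q : ℕ}, q ∣ 5 * Q' → ∀ x : ZMod (5 * Q'), q ∣ (u₀ * x).val ↔ q ∣ x.val := fun hq x =>
    dvd_val_mul_iff_of_isUnit_ct hq hu₀ x
  have hrst₀ : u₀ * r + u₀ * s + u₀ * t = 0 := by rw [← mul_add, ← mul_add, hrst, mul_zero]
  have hrst₀' : u₀ * r' + u₀ * s' + u₀ * t' = 0 := by rw [← mul_add, ← mul_add, hrst', mul_zero]
  have hprim₀ : ∀ q : ℕ, q.Prime → q ∣ 5 * Q' → ¬(q ∣ (u₀ * r).val ∧ q ∣ (u₀ * s).val ∧ q ∣ (u₀ * t).val) := fun q hq hqN h =>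
    hprim q hq hqN ⟨(hdv₀ hqN r).1 h.1, (hdv₀ hqN s).1 h.2.1, (hdv₀ hqN t).1 h.2.2⟩
  have hprim₀' : ∀ q : ℕ, q.Prime → q ∣ 5 * Q' → ¬(q ∣ (u₀ * r').val ∧ q ∣ (u₀ * s').val ∧ q ∣ (u₀ * t').val) := fun q hq hqN h =>
    hprim' q hq hqN ⟨(hdv₀ hqN r').1 h.1, (hdv₀ hqN s').1 h.2.1, (hdv₀ hqN t').1 h.2.2⟩
  have hEq₀ := fermatCMType_mul_eq_ct hu₀ hEq
  have h5r₀ : 5 ∣ (u₀ * r).val := by rw [hu₀r]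
  have h5r₀' : ¬5 ∣ (u₀ * r').val := fun h => h5r' ((hdv₀ (dvd_mul_right 5 Q') r').1 h)
  have h5s₀' : ¬5 ∣ (u₀ * s').val := fun h => h5s' ((hdv₀ (dvd_mul_right 5 Q') s').1 h)
  have h5t₀' : ¬5 ∣ (u₀ * t').val := fun h => h5t' ((hdv₀ (dvd_mul_right 5 Q') t').1 h)
  -- (8) with equality: `s₀ + t₀ = 2Q − 5`
  obtain ⟨hst, -⟩ := residues_three_ct (by omega) (hne₀ hr) hrst₀ (hne₀ hr') hrst₀' hprim₀ hprim₀' hEq₀ hu₀r h5r₀' h5s₀' h5t₀'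
  have hs₀ := Nat.mod_lt (u₀ * s).val hQ0
  have ht₀ := Nat.mod_lt (u₀ * t).val hQ0
  have h5s₀ : ¬5 ∣ (u₀ * s).val := fun h =>
    hprim₀ 5 h5 (dvd_mul_right 5 Q') ⟨h5r₀, h, (dvd_val_iff_of_add_eq_zero hrst₀ h5r₀).1 h⟩
  -- the unit `u₁ ∈ P*` with `⟨u₁u₀s⟩ = N − a`
  obtain ⟨i, u₁, hui, hu₁, hus⟩ := exists_unit_P_ct (by omega) h5s₀ (a := Q' - (u₀ * s).val % Q') (by omega) (by omega) (by omega)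
  set a := Q' - (u₀ * s).val % Q' with ha
  have hu₁r : u₁ * (u₀ * r) = u₀ * r := by
    have := orbit_mul_eq_of_dvd (p := 5) 1 (u₀ * r) h5r₀ i; rwa [one_mul, one_mul, ← hui] at this
  set u := u₁ * u₀ with hudef
  have hu : IsUnit u := hu₁.mul hu₀
  have hur : u * r = u₀ * r := by rw [hudef, mul_assoc, hu₁r]
  have hurv : (u * r).val = 5 := by rw [hur, hu₀r]
  have husv : (u * s).val = 5 * Q' - a := by rw [hudef, mul_assoc, hus]
  have hrstu : u * r + u * s + u * t = 0 := by rw [← mul_add, ← mul_add, hrst, mul_zero]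
  have hrstu' : u * r' + u * s' + u * t' = 0 := by rw [← mul_add, ← mul_add, hrst', mul_zero]
  have hutv : (u * t).val = 5 * Q' - (5 - a) := val_third_ct (by omega) hrstu hurv husv (by omega) (by omega)
  have hdv : ∀ {q : ℕ}, q ∣ 5 * Q' → ∀ x : ZMod (5 * Q'), q ∣ (u * x).val ↔ q ∣ x.val := fun hq x => dvd_val_mul_iff_of_isUnit_ct hq hu x
  have hprimu : ∀ q : ℕ, q.Prime → q ∣ 5 * Q' → ¬(q ∣ (u * r).val ∧ q ∣ (u * s).val ∧ q ∣ (u * t).val) := fun q hq hqN h =>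
    hprim q hq hqN ⟨(hdv hqN r).1 h.1, (hdv hqN s).1 h.2.1, (hdv hqN t).1 h.2.2⟩
  have hprimu' : ∀ q : ℕ, q.Prime → q ∣ 5 * Q' → ¬(q ∣ (u * r').val ∧ q ∣ (u * s').val ∧ q ∣ (u * t').val) := fun q hq hqN h =>
    hprim' q hq hqN ⟨(hdv hqN r').1 h.1, (hdv hqN s').1 h.2.1, (hdv hqN t').1 h.2.2⟩
  have hEqu := fermatCMType_mul_eq_ct hu hEq
  have h5ru' : ¬5 ∣ (u * r').val := fun h => h5r' ((hdv (dvd_mul_right 5 Q') r').1 h)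
  have h5su' : ¬5 ∣ (u * s').val := fun h => h5s' ((hdv (dvd_mul_right 5 Q') s').1 h)
  have h5tu' : ¬5 ∣ (u * t').val := fun h => h5t' ((hdv (dvd_mul_right 5 Q') t').1 h)
  obtain ⟨-, hsum'⟩ := residues_three_ct (by omega) (fun h => hr (hu.mul_right_eq_zero.1 h)) hrstu (fun h => hr' (hu.mul_right_eq_zero.1 h))
    hrstu' hprimu hprimu' hEqu hurv h5ru' h5su' h5tu'
  exact ⟨u, a, hu, by omega, by omega, hurv, husv, hutv, hEqu, h5ru', h5su', h5tu', hsum'⟩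

/-- For `⟨y⟩ = m − c` (`c < m`) and `c⟨h⟩ ≢ 0 (mod m)`: `⟨hy⟩ = m − (c⟨h⟩ mod m)`. [folklore] -/
private theorem val_mul_of_val_eq_sub_ct {m : ℕ} [NeZero m] {y : ZMod m} (h : ZMod m) {c : ℕ} (hcm : c < m) (hy : y.val = m - c)
    (hne : c * h.val % m ≠ 0) : (h * y).val = m - c * h.val % m := by
  have hyc : y = -((c : ℕ) : ZMod m) := by
    rw [← ZMod.natCast_zmod_val y, hy, Nat.cast_sub hcm.le, ZMod.natCast_self, zero_sub]
  have hwv : (((c : ℕ) : ZMod m) * h).val = c * h.val % m := by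
    rw [ZMod.val_mul, ZMod.val_natCast, Nat.mod_eq_of_lt hcm]
  have hw0 : ((c : ℕ) : ZMod m) * h ≠ 0 := fun h0 => hne (by rw [← hwv, h0, ZMod.val_zero])
  have e : h * y = -(((c : ℕ) : ZMod m) * h) := by rw [hyc]; ring
  rw [e, ZMod.neg_val, if_neg hw0, hwv]

omit [NeZero (5 * Q')] in
/-- Arithmetic of `⟨h₀x⟩` for `h₀ = Q − 5`, `⟨x⟩ = N − a`. [folklore] -/
private theorem arith_large_ct {a Q : ℕ} (ha1 : 1 ≤ a) (ha4 : a ≤ 4) (hQ : 7 ≤ Q) (haQ : 5 * a < Q) :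
    a * (Q - 5) < 5 * Q ∧ a * (Q - 5) ≠ 0 ∧ 5 * Q - a * (Q - 5) = (5 - a) * Q + 5 * a ∧
      ((5 - a) * Q + 5 * a) % Q = 5 * a ∧ ((5 - a) * Q + 5 * a) / Q = 5 - a := by
  refine ⟨?_, ?_, ?_, ?_, ?_⟩
  · interval_cases a <;> omega
  · interval_cases a <;> omega
  · interval_cases a <;> omega
  · rw [Nat.mul_comm, Nat.mul_add_mod, Nat.mod_eq_of_lt haQ]
  · rw [Nat.mul_comm, Nat.mul_add_div (by omega), Nat.div_eq_of_lt haQ, add_zero]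

omit [NeZero (5 * Q')] in
/-- The digits along the orbit of `h₀ = Q − 5`: `M₁ + M₂ = 5` off the non-unit point (`5 ∤ 1 + iQ`), `= 0` at it. [folklore] -/
private theorem digits_large_ct (a i Q : ℕ) (ha1 : 1 ≤ a) (ha4 : a ≤ 4) (hi : i < 5) :
    ((5 - a + i * ((5 - a) * Q + 5 * a)) % 5 + (a + i * (a * Q + 5 * (5 - a))) % 5 = 5 ∧ ¬5 ∣ 1 + i * Q) ∨
      ((5 - a + i * ((5 - a) * Q + 5 * a)) % 5 + (a + i * (a * Q + 5 * (5 - a))) % 5 = 0 ∧ 5 ∣ 1 + i * Q) := by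
  obtain ⟨k, m, hm5, rfl⟩ : ∃ k m, m < 5 ∧ Q = 5 * k + m := ⟨Q / 5, Q % 5, Nat.mod_lt _ (by norm_num), (Nat.div_add_mod Q 5).symm⟩
  interval_cases a <;> interval_cases i <;> interval_cases m <;> omega

omit [NeZero (5 * Q')] in
/-- At most one point of the orbit `1 + iQ`, `i < 5`, is divisible by `5`. [folklore] -/
private theorem unique_nonunit_ct {i j Q : ℕ} (hi : i < 5) (hj : j < 5) (h1 : 5 ∣ 1 + i * Q) (h2 : 5 ∣ 1 + j * Q) : i = j := by
  interval_cases i <;> interval_cases j <;> omega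

/-- **CASE 3 AT `p = 5`, `5 ∥ N`, LEVELS `N/5 > 5·max(a, b)` — the orbit of `h₀ = N/5 − 5`** (ours; K–R: "By a tedious examination …
we verify that no such `τ′` exists. The details will be omitted", p. 1197): for `τ = (r, x, z)` with `⟨r⟩ = 5`, `⟨x⟩ = N − a`, `⟨z⟩ = N − b`,
`a + b = 5`, `5a, 5b < Q = N/5`, every UNIT point `u = h₀(1 + iQ)` of the orbit `h₀P` has `⟨ur⟩ + ⟨ux⟩ + ⟨uz⟩ = 2N` (so `u ∉ H_τ`), hence
under `H_τ = H_{τ′}` with `5 ∤ ⟨r′⟩⟨s′⟩⟨t′⟩` the orbit sum `Σ_{i<5} (⟨ur′⟩ + ⟨us′⟩ + ⟨ut′⟩)` is `≥ 4·2N + N = 9N`, whereas the orbit-sum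
formula gives `2·Σ = 10(r₀″ + s₀″ + t₀″) + 12N < 18N`. [cite: KoblitzRohrlich1978, §3 Proposition, Case 3 at `p = 5` (p. 1197)] -/
private theorem false_of_large_three_ct (h5Q : ¬5 ∣ Q') {r x z r' s' t' : ZMod (5 * Q')} (hr5 : r.val = 5) {a : ℕ}
    (hx : x.val = 5 * Q' - a) (hz : z.val = 5 * Q' - (5 - a)) (ha1 : 1 ≤ a) (ha4 : a ≤ 4) (haQ : 5 * a < Q')
    (hbQ : 5 * (5 - a) < Q') (hrst' : r' + s' + t' = 0)
    (hprim' : ∀ q : ℕ, q.Prime → q ∣ 5 * Q' → ¬(q ∣ r'.val ∧ q ∣ s'.val ∧ q ∣ t'.val))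
    (h5r' : ¬5 ∣ r'.val) (h5s' : ¬5 ∣ s'.val) (h5t' : ¬5 ∣ t'.val)
    (hEq : fermatCMType (5 * Q') r x z = fermatCMType (5 * Q') r' s' t') : False := by
  have h5 : (5 : ℕ).Prime := by norm_num
  have hQ7 : 7 ≤ Q' := by omega
  have hQ5c : Nat.Coprime 5 Q' := (Nat.Prime.coprime_iff_not_dvd h5).2 h5Q
  -- the unit `h₀ = Q − 5`
  set h₀ : ZMod (5 * Q') := ((Q' - 5 : ℕ) : ZMod (5 * Q')) with hh₀
  have hh₀v : h₀.val = Q' - 5 := by rw [hh₀, ZMod.val_natCast, Nat.mod_eq_of_lt (by omega)]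
  have hh₀u : IsUnit h₀ := by
    rw [hh₀, ZMod.isUnit_iff_coprime]
    refine Nat.Coprime.mul_right ?_ ((Nat.coprime_self_sub_left (by omega)).2 hQ5c)
    refine ((Nat.Prime.coprime_iff_not_dvd h5).2 fun hd => h5Q ?_).symm
    have e : Q' = Q' - 5 + 5 := by omega
    rw [e]; exact dvd_add hd (dvd_refl 5)
  -- `⟨h₀r⟩ = N − 25`, `⟨h₀x⟩ = bQ + 5a`, `⟨h₀z⟩ = aQ + 5b`
  obtain ⟨haN, ha0, hasub, hamod, hadiv⟩ := arith_large_ct ha1 ha4 hQ7 haQ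
  obtain ⟨hbN, hb0, hbsub, hbmod, hbdiv⟩ := arith_large_ct (a := 5 - a) (by omega) (by omega) hQ7 hbQ
  have e55 : 5 - (5 - a) = a := by omega
  rw [e55] at hbsub hbmod hbdiv
  have h5r : 5 ∣ r.val := ⟨1, by rw [hr5]⟩
  have hr0 : (h₀ * r).val = 5 * Q' - 25 := by
    rw [ZMod.val_mul, hh₀v, hr5, Nat.mod_eq_of_lt (by omega)]; omega
  have hx0 : (h₀ * x).val = (5 - a) * Q' + 5 * a := by
    rw [val_mul_of_val_eq_sub_ct h₀ (by omega : a < 5 * Q') hx (by rw [hh₀v, Nat.mod_eq_of_lt haN]; exact ha0), hh₀v,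
      Nat.mod_eq_of_lt haN, hasub]
  have hz0 : (h₀ * z).val = a * Q' + 5 * (5 - a) := by
    rw [val_mul_of_val_eq_sub_ct h₀ (by omega : 5 - a < 5 * Q') hz (by rw [hh₀v, Nat.mod_eq_of_lt hbN]; exact hb0), hh₀v,
      Nat.mod_eq_of_lt hbN, hbsub]
  -- the orbit `h₀(1 + iQ)` on `τ`
  have hUr : ∀ i : ℕ, (h₀ * (1 + (i : ZMod (5 * Q')) * (Q' : ZMod (5 * Q'))) * r).val = 5 * Q' - 25 := fun i => by
    rw [orbit_mul_eq_of_dvd h₀ r h5r i, hr0]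
  have hUx : ∀ i : ℕ, (h₀ * (1 + (i : ZMod (5 * Q')) * (Q' : ZMod (5 * Q'))) * x).val =
      5 * a + Q' * ((5 - a + i * ((5 - a) * Q' + 5 * a)) % 5) := fun i => by
    rw [val_orbit_mul_eq (p := 5) (by norm_num) h₀ x i, hx0, hamod, hadiv]
  have hUz : ∀ i : ℕ, (h₀ * (1 + (i : ZMod (5 * Q')) * (Q' : ZMod (5 * Q'))) * z).val =
      5 * (5 - a) + Q' * ((a + i * (a * Q' + 5 * (5 - a))) % 5) := fun i => by
    rw [val_orbit_mul_eq (p := 5) (by norm_num) h₀ z i, hz0, hbmod, hbdiv]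
  -- the orbit on `τ′`: each point contributes `≥ N`, every point off the non-unit one contributes `2N`
  set f : ℕ → ℕ := fun i => (h₀ * (1 + (i : ZMod (5 * Q')) * (Q' : ZMod (5 * Q'))) * r').val +
    (h₀ * (1 + (i : ZMod (5 * Q')) * (Q' : ZMod (5 * Q'))) * s').val +
    (h₀ * (1 + (i : ZMod (5 * Q')) * (Q' : ZMod (5 * Q'))) * t').val with hf
  have key : ∀ i, i < 5 → 5 * Q' ≤ f i ∧ (¬5 ∣ 1 + i * Q' → f i = 2 * (5 * Q')) := by
    intro i hi
    set U : ZMod (5 * Q') := h₀ * (1 + (i : ZMod (5 * Q')) * (Q' : ZMod (5 * Q'))) with hU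
    obtain ⟨k, hk2, hk⟩ := exists_val_sum_eq_mul_ct hrst' U
    have hfi : f i = k * (5 * Q') := hk
    have hv : ∀ y : ZMod (5 * Q'), (U * y).val = 0 → Q' ∣ y.val := by
      intro y hy
      rw [hU, val_orbit_mul_eq (p := 5) (by norm_num) h₀ y i] at hy
      have h0 : (h₀ * y).val % Q' = 0 := by omega
      exact dvd_val_of_dvd_val_mul_ct (dvd_mul_left Q' 5) hh₀u (Nat.dvd_of_mod_eq_zero h0)
    have hk0 : k ≠ 0 := by
      intro hk0
      rw [hk0, zero_mul] at hk
      have hQr : Q' ∣ r'.val := hv r' (by omega)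
      have hQs : Q' ∣ s'.val := hv s' (by omega)
      have hQt : Q' ∣ t'.val := hv t' (by omega)
      obtain ⟨q, hq, hqQ⟩ := Nat.exists_prime_and_dvd (by omega : Q' ≠ 1)
      exact hprim' q hq (dvd_mul_of_dvd_right hqQ 5) ⟨hqQ.trans hQr, hqQ.trans hQs, hqQ.trans hQt⟩
    have hk12 : k = 1 ∨ k = 2 := by omega
    refine ⟨by rcases hk12 with rfl | rfl <;> omega, fun hi5 => ?_⟩
    have hUu : IsUnit U := by
      have hcast : U = h₀ * ((1 + i * Q' : ℕ) : ZMod (5 * Q')) := by rw [hU]; push_cast; ring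
      rw [hcast]
      refine hh₀u.mul ?_
      rw [ZMod.isUnit_iff_coprime]
      refine Nat.Coprime.mul_right ((Nat.Prime.coprime_iff_not_dvd h5).2 hi5).symm ?_
      rw [Nat.coprime_add_mul_right_left]; exact Nat.coprime_one_left Q'
    have hτsum : (U * r).val + (U * x).val + (U * z).val = 2 * (5 * Q') := by
      rw [hU, hUr i, hUx i, hUz i]
      rcases digits_large_ct a i Q' ha1 ha4 hi with ⟨hM, -⟩ | ⟨-, hd⟩
      · have hM' : Q' * ((5 - a + i * ((5 - a) * Q' + 5 * a)) % 5) + Q' * ((a + i * (a * Q' + 5 * (5 - a))) % 5) = Q' * 5 := by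
          rw [← Nat.mul_add, hM]
        omega
      · exact absurd hd hi5
    have hnot : U ∉ fermatCMType (5 * Q') r x z := fun hmem => by
      rw [mem_fermatCMType_iff_ct] at hmem
      exact absurd hmem.2 (by omega)
    rw [hEq, mem_fermatCMType_iff_ct] at hnot
    have hcop : U.val.Coprime (5 * Q') := (isUnit_iff_val_coprime_ct U).1 hUu
    have hfN : f i ≠ 5 * Q' := fun h => hnot ⟨hcop, h⟩
    rcases hk12 with rfl | rfl <;> omega
  -- upper bound: the orbit-sum formula
  have hTr := two_mul_sum_val_orbit_mul h5 h₀ r' (not_dvd_val_mul_ct h5 hh₀u r' h5r')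
  have hTs := two_mul_sum_val_orbit_mul h5 h₀ s' (not_dvd_val_mul_ct h5 hh₀u s' h5s')
  have hTt := two_mul_sum_val_orbit_mul h5 h₀ t' (not_dvd_val_mul_ct h5 hh₀u t' h5t')
  have hS : ∑ i ∈ range 5, f i = ∑ i ∈ range 5, (h₀ * (1 + (i : ZMod (5 * Q')) * (Q' : ZMod (5 * Q'))) * r').val +
      ∑ i ∈ range 5, (h₀ * (1 + (i : ZMod (5 * Q')) * (Q' : ZMod (5 * Q'))) * s').val +
      ∑ i ∈ range 5, (h₀ * (1 + (i : ZMod (5 * Q')) * (Q' : ZMod (5 * Q'))) * t').val := by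
    simp only [hf, sum_add_distrib]
  have hρr := Nat.mod_lt (h₀ * r').val (by omega : 0 < Q')
  have hρs := Nat.mod_lt (h₀ * s').val (by omega : 0 < Q')
  have hρt := Nat.mod_lt (h₀ * t').val (by omega : 0 < Q')
  have hup : 2 * ∑ i ∈ range 5, f i < 2 * (9 * (5 * Q')) := by
    rw [hS, Nat.mul_add, Nat.mul_add, hTr, hTs, hTt]
    norm_num
    omega
  -- lower bound: `≥ 9N`
  have hlow : 9 * (5 * Q') ≤ ∑ i ∈ range 5, f i := by
    by_cases hex : ∃ i₀, i₀ < 5 ∧ 5 ∣ 1 + i₀ * Q'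
    · obtain ⟨i₀, hi₀, hdi₀⟩ := hex
      rw [← Finset.add_sum_erase (range 5) f (mem_range.2 hi₀)]
      have hrest : ∑ i ∈ (range 5).erase i₀, f i = ∑ i ∈ (range 5).erase i₀, 2 * (5 * Q') := by
        refine Finset.sum_congr rfl fun i hi => ?_
        obtain ⟨hne, hi5⟩ := Finset.mem_erase.1 hi
        exact (key i (mem_range.1 hi5)).2 fun hd => hne (unique_nonunit_ct (mem_range.1 hi5) hi₀ hd hdi₀)
      rw [hrest, sum_const, card_erase_of_mem (mem_range.2 hi₀), card_range, smul_eq_mul]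
      have := (key i₀ hi₀).1
      omega
    · push Not at hex
      have hall : ∑ i ∈ range 5, f i = ∑ i ∈ range 5, 2 * (5 * Q') :=
        Finset.sum_congr rfl fun i hi => (key i (mem_range.1 hi)).2 (hex i (mem_range.1 hi))
      rw [hall, sum_const, card_range, smul_eq_mul]
      omega
  omega

/-- A witness `w` (a unit at which the two membership conditions differ) separates `H_{(a,b,c)}` from `H_{(a′,b′,c′)}`. [folklore] -/
private theorem ne_of_witness_ct {m : ℕ} [NeZero m] {a b c a' b' c' : ZMod m}
    (h : ∃ w : ZMod m, Nat.gcd w.val m = 1 ∧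
      ¬((w * a).val + (w * b).val + (w * c).val = m ↔ (w * a').val + (w * b').val + (w * c').val = m)) :
    fermatCMType m a b c ≠ fermatCMType m a' b' c' := by
  intro hEq
  obtain ⟨w, hw, hne⟩ := h
  apply hne
  constructor
  · intro h1
    have hm : w ∈ fermatCMType m a b c := (mem_fermatCMType_iff_ct a b c w).2 ⟨hw, h1⟩
    rw [hEq] at hm
    exact ((mem_fermatCMType_iff_ct a' b' c' w).1 hm).2
  · intro h1
    have hm : w ∈ fermatCMType m a' b' c' := (mem_fermatCMType_iff_ct a' b' c' w).2 ⟨hw, h1⟩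
    rw [← hEq] at hm
    exact ((mem_fermatCMType_iff_ct a b c w).1 hm).2

set_option maxRecDepth 100000 in
set_option maxHeartbeats 4000000 in
set_option synthInstance.maxHeartbeats 400000 in
set_option synthInstance.maxSize 100000 in
/-- **Case 3 at `p = 5`, `N = 35`** (kernel computation): for `a ∈ {1, 2}` and every `τ′ = (r′, s′, −r′−s′)` modulo `35` with `5 ∤ ⟨r′⟩, ⟨s′⟩, ⟨−r′−s′⟩` there is a unit `w` at which the membership conditions of `H_{(5, −a, a−5)}` and `H_{τ′}` differ (so `H_{(5,−a,a−5)} ≠ H_{τ′}`).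
[cite: KoblitzRohrlich1978, §3 Proposition, Case 3 at `p = 5` (p. 1197; "the case `N = 35` was checked separately by hand", p. 1196)] -/
private theorem witness_thirtyFive_ct : ∀ a : ℕ, a < 3 → 1 ≤ a → ∀ r' s' : ZMod (5 * 7), ¬5 ∣ r'.val → ¬5 ∣ s'.val →
    ¬5 ∣ (-r' - s').val → ∃ w : ZMod (5 * 7), Nat.gcd w.val (5 * 7) = 1 ∧
      ¬(((w * 5).val + (w * -((a : ℕ) : ZMod (5 * 7))).val + (w * (((a : ℕ) : ZMod (5 * 7)) - 5)).val = 5 * 7) ↔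
        ((w * r').val + (w * s').val + (w * (-r' - s')).val = 5 * 7)) := by
  decide

set_option maxRecDepth 100000 in
set_option maxHeartbeats 4000000 in
set_option synthInstance.maxHeartbeats 400000 in
set_option synthInstance.maxSize 100000 in
/-- **Case 3 at `p = 5`, `N = 55`** (kernel computation), `a ∈ {1, 2}`: a separating unit `w` for `H_{(5,−a,a−5)}` and every `H_{τ′}`, `5 ∤ ⟨r′⟩⟨s′⟩⟨t′⟩`.
[cite: KoblitzRohrlich1978, §3 Proposition, Case 3 at `p = 5` (p. 1197)] -/
private theorem witness_fiftyFive_ct : ∀ a : ℕ, a < 3 → 1 ≤ a → ∀ r' s' : ZMod (5 * 11), ¬5 ∣ r'.val → ¬5 ∣ s'.val →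
    ¬5 ∣ (-r' - s').val → ∃ w : ZMod (5 * 11), Nat.gcd w.val (5 * 11) = 1 ∧
      ¬(((w * 5).val + (w * -((a : ℕ) : ZMod (5 * 11))).val + (w * (((a : ℕ) : ZMod (5 * 11)) - 5)).val = 5 * 11) ↔
        ((w * r').val + (w * s').val + (w * (-r' - s')).val = 5 * 11)) := by
  decide

set_option maxRecDepth 100000 in
set_option maxHeartbeats 4000000 in
set_option synthInstance.maxHeartbeats 400000 in
set_option synthInstance.maxSize 100000 in
/-- **Case 3 at `p = 5`, `N = 65`** (kernel computation), `a ∈ {1, 2}`: a separating unit `w` for `H_{(5,−a,a−5)}` and every `H_{τ′}`, `5 ∤ ⟨r′⟩⟨s′⟩⟨t′⟩`.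
[cite: KoblitzRohrlich1978, §3 Proposition, Case 3 at `p = 5` (p. 1197)] -/
private theorem witness_sixtyFive_ct : ∀ a : ℕ, a < 3 → 1 ≤ a → ∀ r' s' : ZMod (5 * 13), ¬5 ∣ r'.val → ¬5 ∣ s'.val →
    ¬5 ∣ (-r' - s').val → ∃ w : ZMod (5 * 13), Nat.gcd w.val (5 * 13) = 1 ∧
      ¬(((w * 5).val + (w * -((a : ℕ) : ZMod (5 * 13))).val + (w * (((a : ℕ) : ZMod (5 * 13)) - 5)).val = 5 * 13) ↔
        ((w * r').val + (w * s').val + (w * (-r' - s')).val = 5 * 13)) := by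
  decide

set_option maxRecDepth 100000 in
set_option maxHeartbeats 4000000 in
set_option synthInstance.maxHeartbeats 400000 in
set_option synthInstance.maxSize 100000 in
/-- **Case 3 at `p = 5`, `N = 85`** (kernel computation), `a = 1` (for `a = 2` the level is large: `5·3 < 17`): a separating unit `w` for `H_{(5,−1,−4)}` and every `H_{τ′}`, `5 ∤ ⟨r′⟩⟨s′⟩⟨t′⟩`.
[cite: KoblitzRohrlich1978, §3 Proposition, Case 3 at `p = 5` (p. 1197)] -/
private theorem witness_eightyFive_ct : ∀ a : ℕ, a < 2 → 1 ≤ a → ∀ r' s' : ZMod (5 * 17), ¬5 ∣ r'.val → ¬5 ∣ s'.val →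
    ¬5 ∣ (-r' - s').val → ∃ w : ZMod (5 * 17), Nat.gcd w.val (5 * 17) = 1 ∧
      ¬(((w * 5).val + (w * -((a : ℕ) : ZMod (5 * 17))).val + (w * (((a : ℕ) : ZMod (5 * 17)) - 5)).val = 5 * 17) ↔
        ((w * r').val + (w * s').val + (w * (-r' - s')).val = 5 * 17)) := by
  decide

set_option maxRecDepth 100000 in
set_option maxHeartbeats 4000000 in
set_option synthInstance.maxHeartbeats 400000 in
set_option synthInstance.maxSize 100000 in
/-- **Case 3 at `p = 5`, `N = 95`** (kernel computation), `a = 1` (for `a = 2` the level is large: `5·3 < 19`): a separating unit `w` for `H_{(5,−1,−4)}` and every `H_{τ′}`, `5 ∤ ⟨r′⟩⟨s′⟩⟨t′⟩`.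
[cite: KoblitzRohrlich1978, §3 Proposition, Case 3 at `p = 5` (p. 1197)] -/
private theorem witness_ninetyFive_ct : ∀ a : ℕ, a < 2 → 1 ≤ a → ∀ r' s' : ZMod (5 * 19), ¬5 ∣ r'.val → ¬5 ∣ s'.val →
    ¬5 ∣ (-r' - s').val → ∃ w : ZMod (5 * 19), Nat.gcd w.val (5 * 19) = 1 ∧
      ¬(((w * 5).val + (w * -((a : ℕ) : ZMod (5 * 19))).val + (w * (((a : ℕ) : ZMod (5 * 19)) - 5)).val = 5 * 19) ↔
        ((w * r').val + (w * s').val + (w * (-r' - s')).val = 5 * 19)) := by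
  decide

/-- **CASE 3 AT `p = 5`, `5 ∥ N`, SMALL LEVELS** `N/5 ≤ 5·max(a, b)`, i.e. `N ∈ {35, 55, 65, 85, 95}` (`N/5` prime to `30`, `7 ≤ N/5 ≤
20`): for `τ = (r, x, z)` with `⟨r⟩ = 5`, `⟨x⟩ = N − a`, `⟨z⟩ = N − (5 − a)`, `a ∈ {1, 2}`, and `τ′` with `5 ∤ ⟨r′⟩⟨s′⟩⟨t′⟩`, `H_τ ≠ H_{τ′}` —
by the five kernel computations (`r = 5`, `x = −a`, `z = a − 5` as residues). [cite: KoblitzRohrlich1978, §3 Proposition, Case 3 at `p = 5` (p. 1197)] -/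
private theorem false_of_small_three_ct (hN2 : Nat.Coprime 2 (5 * Q')) (hN3 : Nat.Coprime 3 (5 * Q')) (h5Q : ¬5 ∣ Q')
    {r x z r' s' t' : ZMod (5 * Q')} (hr5 : r.val = 5) {a : ℕ} (hx : x.val = 5 * Q' - a) (hz : z.val = 5 * Q' - (5 - a))
    (ha1 : 1 ≤ a) (ha2 : a ≤ 2) (hsmall : ¬(5 * a < Q' ∧ 5 * (5 - a) < Q')) (hrst' : r' + s' + t' = 0)
    (h5r' : ¬5 ∣ r'.val) (h5s' : ¬5 ∣ s'.val) (h5t' : ¬5 ∣ t'.val)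
    (hEq : fermatCMType (5 * Q') r x z = fermatCMType (5 * Q') r' s' t') : False := by
  have h5 : (5 : ℕ).Prime := by norm_num
  have hQ2 : 2 ≤ Q' := by have := ZMod.val_lt r; omega
  have hQ0 : 0 < Q' := by omega
  have hQ7 : 7 ≤ Q' := seven_le_of_dvd_ct hQ0 (Nat.Coprime.coprime_dvd_right (dvd_mul_left Q' 5) hN2)
    (Nat.Coprime.coprime_dvd_right (dvd_mul_left Q' 5) hN3) ((Nat.Prime.coprime_iff_not_dvd h5).2 h5Q) (dvd_refl Q') (by omega)
  have hQ20 : Q' ≤ 20 := by omega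
  have hre : r = 5 := by rw [← ZMod.natCast_zmod_val r, hr5, Nat.cast_ofNat]
  have hxe : x = -((a : ℕ) : ZMod (5 * Q')) := by
    rw [← ZMod.natCast_zmod_val x, hx, Nat.cast_sub (by omega), ZMod.natCast_self, zero_sub]
  have hze : z = ((a : ℕ) : ZMod (5 * Q')) - 5 := by
    rw [← ZMod.natCast_zmod_val z, hz, Nat.cast_sub (by omega), ZMod.natCast_self, zero_sub, Nat.cast_sub (by omega),
      Nat.cast_ofNat]
    ring
  have hte : t' = -r' - s' := by linear_combination hrst'
  rw [hre, hxe, hze, hte] at hEq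
  rw [hte] at h5t'
  have hQ2' : ¬2 ∣ Q' := fun h => by have := Nat.Coprime.eq_one_of_dvd hN2 (h.trans (dvd_mul_left Q' 5)); omega
  have hQ3' : ¬3 ∣ Q' := fun h => by have := Nat.Coprime.eq_one_of_dvd hN3 (h.trans (dvd_mul_left Q' 5)); omega
  obtain rfl | rfl | rfl | rfl | rfl : Q' = 7 ∨ Q' = 11 ∨ Q' = 13 ∨ Q' = 17 ∨ Q' = 19 := by omega
  · exact ne_of_witness_ct (witness_thirtyFive_ct a (by omega) ha1 r' s' h5r' h5s' h5t') hEq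
  · exact ne_of_witness_ct (witness_fiftyFive_ct a (by omega) ha1 r' s' h5r' h5s' h5t') hEq
  · exact ne_of_witness_ct (witness_sixtyFive_ct a (by omega) ha1 r' s' h5r' h5s' h5t') hEq
  · exact ne_of_witness_ct (witness_eightyFive_ct a (by omega) ha1 r' s' h5r' h5s' h5t') hEq
  · exact ne_of_witness_ct (witness_ninetyFive_ct a (by omega) ha1 r' s' h5r' h5s' h5t') hEq

/-- **CASE 3 AT `p = 5`, `5 ∥ N` — K–R's OMITTED STEP, SETTLED**: at every `N = 5Q` prime to `6` with `5 ∤ Q`, for admissible primitive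
`τ, τ′` (six non-zero entries, sums `0`) with `5 ∣ ⟨r⟩` and `5 ∤ ⟨r′⟩, ⟨s′⟩, ⟨t′⟩`: **`H_τ ≠ H_{τ′}`** ("Case 3. There exists a prime `p` such
that `p | N, r`, but `p ∤ str′s′t′`" is impossible at `p = 5`, `5² ∤ N` too).  K–R: "By a tedious examination of the possible `τ′` for which
`r₀′ + s₀′ + t₀′ = N/5` and `H_{τ′}` is given by (10) we verify that no such `τ′` exists. The details will be omitted."  PROOF HERE: K–R's printed
reduction to `τ = (5, N − a, N − b)` (`case_three_five_reduction`), then — OURS — the orbit of `h₀ = N/5 − 5` when `N/5 > 5·max(a, b)`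
(`false_of_large_three_ct`: its four unit points lie outside `H_τ`, forcing the `τ′`-orbit sum `≥ 9N > 5(r₀″+s₀″+t₀″) + 6N`), and kernel
computations at the five levels `N ∈ {35, 55, 65, 85, 95}` with `N/5 ≤ 20` (a separating unit for every `τ′`).
[cite: KoblitzRohrlich1978, §3 Proposition, Case 3 at `p = 5` (p. 1197)] -/
theorem fermatCMType_ne_of_five_dvd_of_not_dvd (hN2 : Nat.Coprime 2 (5 * Q')) (hN3 : Nat.Coprime 3 (5 * Q')) (h5Q : ¬5 ∣ Q')
    {r s t r' s' t' : ZMod (5 * Q')} (hr : r ≠ 0) (hs : s ≠ 0) (ht : t ≠ 0) (hrst : r + s + t = 0)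
    (hr' : r' ≠ 0) (hs' : s' ≠ 0) (ht' : t' ≠ 0) (hrst' : r' + s' + t' = 0)
    (hprim : ∀ q : ℕ, q.Prime → q ∣ 5 * Q' → ¬(q ∣ r.val ∧ q ∣ s.val ∧ q ∣ t.val))
    (hprim' : ∀ q : ℕ, q.Prime → q ∣ 5 * Q' → ¬(q ∣ r'.val ∧ q ∣ s'.val ∧ q ∣ t'.val))
    (h5r : 5 ∣ r.val) (h5r' : ¬5 ∣ r'.val) (h5s' : ¬5 ∣ s'.val) (h5t' : ¬5 ∣ t'.val) :
    fermatCMType (5 * Q') r s t ≠ fermatCMType (5 * Q') r' s' t' := by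
  intro hEq
  obtain ⟨u, a, hu, ha1, ha4, hur, hus, hut, hEqu, h5ur', h5us', h5ut', -⟩ :=
    case_three_five_reduction hN2 hN3 h5Q hr hs ht hrst hr' hs' ht' hrst' hprim hprim' h5r h5r' h5s' h5t' hEq
  have hrstu' : u * r' + u * s' + u * t' = 0 := by rw [← mul_add, ← mul_add, hrst', mul_zero]
  have hdv : ∀ {q : ℕ}, q ∣ 5 * Q' → ∀ x : ZMod (5 * Q'), q ∣ (u * x).val ↔ q ∣ x.val := fun hq x =>
    dvd_val_mul_iff_of_isUnit_ct hq hu x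
  have hprimu' : ∀ q : ℕ, q.Prime → q ∣ 5 * Q' → ¬(q ∣ (u * r').val ∧ q ∣ (u * s').val ∧ q ∣ (u * t').val) := fun q hq hqN h =>
    hprim' q hq hqN ⟨(hdv hqN r').1 h.1, (hdv hqN s').1 h.2.1, (hdv hqN t').1 h.2.2⟩
  by_cases hlarge : 5 * a < Q' ∧ 5 * (5 - a) < Q'
  · exact false_of_large_three_ct h5Q hur hus hut ha1 ha4 hlarge.1 hlarge.2 hrstu' hprimu' h5ur' h5us' h5ut' hEqu
  rcases Nat.lt_or_ge a 3 with ha3 | ha3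
  · exact false_of_small_three_ct hN2 hN3 h5Q hur hus hut ha1 (by omega) hlarge hrstu' h5ur' h5us' h5ut' hEqu
  · have hus' : (u * s).val = 5 * Q' - (5 - (5 - a)) := by rw [show 5 - (5 - a) = a by omega]; exact hus
    exact false_of_small_three_ct hN2 hN3 h5Q hur hut hus' (by omega) (by omega) (by omega) hrstu' h5ur' h5us' h5ut'
      ((fermatCMType_swap₂₃_ct (u * r) (u * t) (u * s)).trans hEqu)

/-- **Case 3 at `p = 5`, `5 ∥ N`, general-level form**: `N` prime to `6`, `5 ∣ N`, `25 ∤ N`, admissible primitive `τ, τ′`, `5 ∣ ⟨r⟩`,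
`5 ∤ ⟨r′⟩, ⟨s′⟩, ⟨t′⟩` ⟹ `H_τ ≠ H_{τ′}`. [cite: KoblitzRohrlich1978, §3 Proposition, Case 3 at `p = 5` (p. 1197)] -/
theorem fermatCMType_ne_of_five_dvd_of_not_dvd_level {N : ℕ} [NeZero N] (hN2 : Nat.Coprime 2 N) (hN3 : Nat.Coprime 3 N) (h5N : 5 ∣ N)
    (h25 : ¬5 * 5 ∣ N) {r s t r' s' t' : ZMod N} (hr : r ≠ 0) (hs : s ≠ 0) (ht : t ≠ 0) (hrst : r + s + t = 0)
    (hr' : r' ≠ 0) (hs' : s' ≠ 0) (ht' : t' ≠ 0) (hrst' : r' + s' + t' = 0)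
    (hprim : ∀ q : ℕ, q.Prime → q ∣ N → ¬(q ∣ r.val ∧ q ∣ s.val ∧ q ∣ t.val))
    (hprim' : ∀ q : ℕ, q.Prime → q ∣ N → ¬(q ∣ r'.val ∧ q ∣ s'.val ∧ q ∣ t'.val))
    (h5r : 5 ∣ r.val) (h5r' : ¬5 ∣ r'.val) (h5s' : ¬5 ∣ s'.val) (h5t' : ¬5 ∣ t'.val) :
    fermatCMType N r s t ≠ fermatCMType N r' s' t' := by
  obtain ⟨Q, rfl⟩ := h5N
  exact fermatCMType_ne_of_five_dvd_of_not_dvd hN2 hN3 (fun h => h25 (Nat.mul_dvd_mul_left 5 h)) hr hs ht hrst hr' hs' ht' hrst' hprim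
    hprim' h5r h5r' h5s' h5t'

/-- **A boundary entry at `5` matches, at `5 ∥ N`** (Cases 2 AND 3 at `p = 5`, both now complete): `N` prime to `6`, `5 ∣ N`, `25 ∤ N`,
admissible primitive `τ, τ′`, `H_τ = H_{τ′}`, `5 ∣ ⟨r⟩` ⟹ **`r = r′ ∨ r = s′ ∨ r = t′`**.
[cite: KoblitzRohrlich1978, §3 Proposition, Cases 2–3 at `p = 5` (pp. 1196–1197)] -/
theorem eq_or_eq_or_eq_of_fermatCMType_eq_of_five_dvd_exact {N : ℕ} [NeZero N] (hN2 : Nat.Coprime 2 N) (hN3 : Nat.Coprime 3 N)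
    (h5N : 5 ∣ N) (h25 : ¬5 * 5 ∣ N) {r s t r' s' t' : ZMod N} (hr : r ≠ 0) (hs : s ≠ 0) (ht : t ≠ 0) (hrst : r + s + t = 0)
    (hr' : r' ≠ 0) (hs' : s' ≠ 0) (ht' : t' ≠ 0) (hrst' : r' + s' + t' = 0)
    (hprim : ∀ q : ℕ, q.Prime → q ∣ N → ¬(q ∣ r.val ∧ q ∣ s.val ∧ q ∣ t.val))
    (hprim' : ∀ q : ℕ, q.Prime → q ∣ N → ¬(q ∣ r'.val ∧ q ∣ s'.val ∧ q ∣ t'.val))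
    (h5r : 5 ∣ r.val) (hEq : fermatCMType N r s t = fermatCMType N r' s' t') : r = r' ∨ r = s' ∨ r = t' := by
  by_cases h5' : 5 ∣ r'.val ∨ 5 ∣ s'.val ∨ 5 ∣ t'.val
  · exact eq_or_eq_or_eq_of_fermatCMType_eq_of_five_dvd_of_dvd hN2 hN3 h5N h25 hr hs ht hrst hr' hs' ht' hrst' hprim hprim' h5r h5' hEq
  · push Not at h5'
    exact absurd hEq (fermatCMType_ne_of_five_dvd_of_not_dvd_level hN2 hN3 h5N h25 hr hs ht hrst hr' hs' ht' hrst' hprim hprim' h5r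
      h5'.1 h5'.2.1 h5'.2.2)

end CaseThreeFive

/-! ## §2 THE PROPOSITION AND THEOREM 1 (ii) FOR BOUNDARY TRIPLES AT EVERY LEVEL PRIME TO `6` — no level clause, no regime clause -/

section AssemblyAll

variable {N : ℕ} [NeZero N]

/-- **A boundary entry matches, at EVERY level `N` prime to `6`**: for a prime `p ∣ N` with `p ∣ ⟨r⟩`, admissible primitive `τ, τ′` (six
non-zero entries) and `H_τ = H_{τ′}`: **`r = r′ ∨ r = s′ ∨ r = t′`** (`p = 5`: `5² ∣ N` by gen 39's `…_of_dvd_level`, `5 ∥ N` by the sibling's §8 (Case 2) and §1 here (Case 3); `p = 7`: the sibling's §3;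
`p ≥ 11`: the sibling). [cite: KoblitzRohrlich1978, §3 Proposition, Cases 2–3 (pp. 1195–1197)] -/
theorem eq_or_eq_or_eq_of_fermatCMType_eq_of_dvd_all (hN2 : Nat.Coprime 2 N) (hN3 : Nat.Coprime 3 N) {p : ℕ} (hp : p.Prime)
    (hpN : p ∣ N) {r s t r' s' t' : ZMod N} (hr : r ≠ 0) (hs : s ≠ 0) (ht : t ≠ 0) (hrst : r + s + t = 0) (hr' : r' ≠ 0) (hs' : s' ≠ 0)
    (ht' : t' ≠ 0) (hrst' : r' + s' + t' = 0) (hprim : ∀ q : ℕ, q.Prime → q ∣ N → ¬(q ∣ r.val ∧ q ∣ s.val ∧ q ∣ t.val))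
    (hprim' : ∀ q : ℕ, q.Prime → q ∣ N → ¬(q ∣ r'.val ∧ q ∣ s'.val ∧ q ∣ t'.val))
    (hpr : p ∣ r.val) (hEq : fermatCMType N r s t = fermatCMType N r' s' t') : r = r' ∨ r = s' ∨ r = t' := by
  by_cases h5 : ¬5 ∣ N ∨ 5 * 5 ∣ N
  · exact eq_or_eq_or_eq_of_fermatCMType_eq_of_dvd_of_not_five_or_sq hN2 hN3 h5 hp hpN hr hs ht hrst hr' hs' ht' hrst' hprim hprim' hpr
      hEq
  push Not at h5
  have hp5 : 5 ≤ p := five_le_of_prime_dvd_ct hN2 hN3 hp hpN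
  by_cases hp5' : p = 5
  · subst hp5'
    exact eq_or_eq_or_eq_of_fermatCMType_eq_of_five_dvd_exact hN2 hN3 h5.1 h5.2 hr hs ht hrst hr' hs' ht' hrst' hprim hprim' hpr hEq
  by_cases hp7 : p = 7
  · subst hp7
    obtain ⟨Q, rfl⟩ := hpN
    exact eq_or_eq_or_eq_of_fermatCMType_eq_of_seven_dvd hN2 hN3 hr hs ht hrst hr' hs' ht' hrst' hprim hprim' hpr hEq
  exact eq_or_eq_or_eq_of_fermatCMType_eq_of_dvd_level hp hp5 hpN (Or.inr (eleven_le_of_ne_ct hp hp5 hp5' hp7)) hN2 hN3 hr hrst hr'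
    hs' ht' hrst' hprim hprim' hpr hEq

/-- The matched form at every level prime to `6`: `r = r′` and a prime `p ∣ N` dividing `⟨s⟩` ⟹ `{r, s, t} = {r′, s′, t′}`.
[cite: KoblitzRohrlich1978, §3 Proposition (p. 1193), Cases 2–3 (pp. 1195–1197)] -/
theorem multiset_eq_of_fermatCMType_eq_of_eq_of_dvd_all (hN2 : Nat.Coprime 2 N) (hN3 : Nat.Coprime 3 N) {p : ℕ} (hp : p.Prime)
    (hpN : p ∣ N) {r s t r' s' t' : ZMod N} (hr : r ≠ 0) (hs : s ≠ 0) (ht : t ≠ 0) (hrst : r + s + t = 0) (hr' : r' ≠ 0) (hs' : s' ≠ 0)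
    (ht' : t' ≠ 0) (hrst' : r' + s' + t' = 0) (hprim : ∀ q : ℕ, q.Prime → q ∣ N → ¬(q ∣ r.val ∧ q ∣ s.val ∧ q ∣ t.val))
    (hprim' : ∀ q : ℕ, q.Prime → q ∣ N → ¬(q ∣ r'.val ∧ q ∣ s'.val ∧ q ∣ t'.val))
    (hEq : fermatCMType N r s t = fermatCMType N r' s' t') (hrr' : r = r') (hps : p ∣ s.val) :
    ({r, s, t} : Multiset (ZMod N)) = {r', s', t'} := by
  have hstr : s + t + r = 0 := by rw [show s + t + r = r + s + t by ring]; exact hrst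
  have hEq₁ : fermatCMType N s t r = fermatCMType N r' s' t' :=
    ((fermatCMType_swap₁₃_ct s t r).trans (fermatCMType_swap₂₃_ct r t s)).trans hEq
  rcases eq_or_eq_or_eq_of_fermatCMType_eq_of_dvd_all hN2 hN3 hp hpN hs ht hr hstr hr' hs' ht' hrst'
      (fun q hq hqN h => hprim q hq hqN ⟨h.2.2, h.1, h.2.1⟩) hprim' hps hEq₁ with h | h | h
  · have hpr : p ∣ r.val := by rw [hrr', ← h]; exact hps
    exact absurd ⟨hpr, hps, dvd_val_of_add_eq_zero_ct hpN hrst hpr hps⟩ (hprim p hp hpN)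
  · subst hrr' h
    have htt' : t = t' := by linear_combination hrst - hrst'
    rw [htt']
  · subst hrr' h
    have hts' : t = s' := by linear_combination hrst - hrst'
    rw [hts', Multiset.pair_comm]

/-- **KOBLITZ–ROHRLICH §3 PROPOSITION AT EVERY LEVEL `N` PRIME TO `6` — NO LEVEL CLAUSE, NO REGIME CLAUSE, THE OMITTED CASE INCLUDED**: for
admissible primitive `τ = (r, s, t)`, `τ′ = (r′, s′, t′)` modulo `N` (non-zero entries, `r + s + t = 0 = r′ + s′ + t′`, no prime of `N` dividing
all of `⟨r⟩, ⟨s⟩, ⟨t⟩`, resp. `⟨r′⟩, ⟨s′⟩, ⟨t′⟩`) with `H_τ = H_{τ′}`, a prime of `N` dividing `⟨r⟩` ("`N` is not prime to `rstr′s′t′`") and a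
prime of `N` dividing `⟨s⟩` or `⟨t⟩` ("in the case that `r = r′` for some ordering …, `N` is not prime to `sts′t′`"): **`{r, s, t} =
{r′, s′, t′}`** — "`τ′` is a permutation of `τ`".  This supersedes the sibling's §3 (`5 ∤ N ∨ 5² ∣ N`) and every regime form of gen 39.
[cite: KoblitzRohrlich1978, §3 Proposition (p. 1193), Cases 1–3 (pp. 1193–1197)] -/
theorem multiset_eq_of_fermatCMType_eq_of_dvd_of_dvd_all (hN2 : Nat.Coprime 2 N) (hN3 : Nat.Coprime 3 N) {p : ℕ} (hp : p.Prime)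
    (hpN : p ∣ N) {q : ℕ} (hq : q.Prime) (hqN : q ∣ N) {r s t r' s' t' : ZMod N}
    (hr : r ≠ 0) (hs : s ≠ 0) (ht : t ≠ 0) (hrst : r + s + t = 0) (hr' : r' ≠ 0) (hs' : s' ≠ 0) (ht' : t' ≠ 0) (hrst' : r' + s' + t' = 0)
    (hprim : ∀ q : ℕ, q.Prime → q ∣ N → ¬(q ∣ r.val ∧ q ∣ s.val ∧ q ∣ t.val))
    (hprim' : ∀ q : ℕ, q.Prime → q ∣ N → ¬(q ∣ r'.val ∧ q ∣ s'.val ∧ q ∣ t'.val))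
    (hEq : fermatCMType N r s t = fermatCMType N r' s' t') (hpr : p ∣ r.val) (hqst : q ∣ s.val ∨ q ∣ t.val) :
    ({r, s, t} : Multiset (ZMod N)) = {r', s', t'} := by
  obtain ⟨r₁, s₁, t₁, hr₁, hs₁, ht₁, hrst₁, hprim₁, hEq', hperm, hrr₁⟩ : ∃ r₁ s₁ t₁ : ZMod N, r₁ ≠ 0 ∧ s₁ ≠ 0 ∧ t₁ ≠ 0 ∧
      r₁ + s₁ + t₁ = 0 ∧ (∀ q : ℕ, q.Prime → q ∣ N → ¬(q ∣ r₁.val ∧ q ∣ s₁.val ∧ q ∣ t₁.val)) ∧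
      fermatCMType N r s t = fermatCMType N r₁ s₁ t₁ ∧ ({r₁, s₁, t₁} : Multiset (ZMod N)) = {r', s', t'} ∧ r = r₁ := by
    rcases eq_or_eq_or_eq_of_fermatCMType_eq_of_dvd_all hN2 hN3 hp hpN hr hs ht hrst hr' hs' ht' hrst' hprim hprim' hpr hEq with
      h | h | h
    · exact ⟨r', s', t', hr', hs', ht', hrst', hprim', hEq, rfl, h⟩
    · exact ⟨s', r', t', hs', hr', ht', by rw [add_comm s' r']; exact hrst', fun q hq hqN h' => hprim' q hq hqN ⟨h'.2.1, h'.1, h'.2.2⟩,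
        hEq.trans (fermatCMType_swap₁₂_ct r' s' t'), Multiset.cons_swap s' r' {t'}, h⟩
    · exact ⟨t', s', r', ht', hs', hr', by rw [show t' + s' + r' = r' + s' + t' by ring]; exact hrst',
        fun q hq hqN h' => hprim' q hq hqN ⟨h'.2.2, h'.2.1, h'.1⟩, hEq.trans (fermatCMType_swap₁₃_ct r' s' t'),
        calc ({t', s', r'} : Multiset (ZMod N)) = {t', r', s'} := by rw [Multiset.pair_comm s' r']
          _ = {r', t', s'} := Multiset.cons_swap t' r' {s'}
          _ = {r', s', t'} := by rw [Multiset.pair_comm t' s'], h⟩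
  rw [← hperm]
  rcases hqst with hqs | hqt
  · exact multiset_eq_of_fermatCMType_eq_of_eq_of_dvd_all hN2 hN3 hq hqN hr hs ht hrst hr₁ hs₁ ht₁ hrst₁ hprim hprim₁ hEq' hrr₁ hqs
  · have h := multiset_eq_of_fermatCMType_eq_of_eq_of_dvd_all hN2 hN3 hq hqN hr ht hs (by rw [show r + t + s = r + s + t by ring]; exact hrst)
      hr₁ hs₁ ht₁ hrst₁ (fun q hq hqN h' => hprim q hq hqN ⟨h'.1, h'.2.2, h'.2.1⟩) hprim₁ ((fermatCMType_swap₂₃_ct r t s).trans hEq') hrr₁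
      hqt
    rw [← h, Multiset.pair_comm]

/-- **The Proposition with its printed hypotheses at every level prime to `6`**: `2, 3 ∤ N`; "g.c.d.`(r, s, t, r′, s′, t′) = 1`" (no prime of
`N` divides all six representatives), "`N` not prime to `rstr′s′t′`" (a prime of `N` divides `⟨r⟩`), "in the case `r = r′` …, `N` not prime
to `sts′t′`" (a prime of `N` divides `⟨s⟩` or `⟨t⟩`), `H_τ = H_{τ′}` ⟹ **`{r, s, t} = {r′, s′, t′}`**.
[cite: KoblitzRohrlich1978, §3 Proposition (p. 1193), Cases 1–3 (pp. 1193–1197)] -/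
theorem multiset_eq_of_fermatCMType_eq_of_gcd_six_all (hN2 : Nat.Coprime 2 N) (hN3 : Nat.Coprime 3 N) {p : ℕ} (hp : p.Prime)
    (hpN : p ∣ N) {q : ℕ} (hq : q.Prime) (hqN : q ∣ N) {r s t r' s' t' : ZMod N}
    (hr : r ≠ 0) (hs : s ≠ 0) (ht : t ≠ 0) (hrst : r + s + t = 0) (hr' : r' ≠ 0) (hs' : s' ≠ 0) (ht' : t' ≠ 0) (hrst' : r' + s' + t' = 0)
    (hsix : ∀ q : ℕ, q.Prime → q ∣ N → ¬(q ∣ r.val ∧ q ∣ s.val ∧ q ∣ t.val ∧ q ∣ r'.val ∧ q ∣ s'.val ∧ q ∣ t'.val))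
    (hpr : p ∣ r.val) (hqst : q ∣ s.val ∨ q ∣ t.val) (hEq : fermatCMType N r s t = fermatCMType N r' s' t') :
    ({r, s, t} : Multiset (ZMod N)) = {r', s', t'} := by
  obtain ⟨hprim, hprim'⟩ := primitive_of_fermatCMType_eq_of_gcd_six hN2 hN3 hr hs ht hrst hr' hs' ht' hrst' hsix hEq
  exact multiset_eq_of_fermatCMType_eq_of_dvd_of_dvd_all hN2 hN3 hp hpN hq hqN hr hs ht hrst hr' hs' ht' hrst' hprim hprim' hEq hpr hqst

/-! ### On abelian varieties: Theorem 1 (ii) for boundary triples at every level prime to `6` -/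

open Literature.AlgebraicGeometry.Motives (AbelianVariety)
open Literature.AlgebraicGeometry.HodgeTheory (complexBetti)
open Literature.AlgebraicGeometry.Pohlmann1968.Cyclotomic (cmTypeOfResidues)
open CyclotomicCMTypeResidueSets (IsCMResidueSet)
open NumberField

variable {L : Type} [Field L] [NumberField L] [IsCyclotomicExtension {N} ℚ L]
  {A A' : AbelianVariety ℂ} {ι : 𝓞 L →+* CategoryTheory.End A} {θ : L →+* Module.End ℂ (complexBetti A.X 1)}
  {ι' : 𝓞 L →+* CategoryTheory.End A'} {θ' : L →+* Module.End ℂ (complexBetti A'.X 1)}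

/-- **THEOREM 1 (ii) FOR BOUNDARY TRIPLES AT EVERY `N` PRIME TO `6`, ON ABELIAN VARIETIES** ("The only isogenies between the lattices
`L_{r,s,t}` are the obvious equalities"): realisations `A`, `A′` of the full-level types `Φ_{H_τ}`, `Φ_{H_{τ′}}` of `ℚ(ζ_N)` (`τ, τ′` admissible
primitive, a prime of `N` dividing `⟨r⟩`, a prime of `N` dividing `⟨s⟩` or `⟨t⟩`) are ISOGENOUS **iff `{r′, s′, t′} = {ur, us, ut}` for a unit
`u`** (Shimura–Taniyama, tree `isIsogenous_fermatCMType_iff_exists_eq_mul`; then the Proposition for `uτ`).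
[cite: KoblitzRohrlich1978, Theorem 1 (ii) (p. 1185), §3 Proposition (pp. 1193–1197)] [cite: Shimura1998, §6.1 Corollary and §8.4 Example (1)] -/
theorem isIsogenous_iff_exists_unit_multiset_eq_all [IsCMField L] (hN2 : Nat.Coprime 2 N) (hN3 : Nat.Coprime 3 N) {p : ℕ}
    (hp : p.Prime) (hpN : p ∣ N) {q : ℕ} (hq : q.Prime) (hqN : q ∣ N) {r s t r' s' t' : ZMod N}
    (hr : r ≠ 0) (hs : s ≠ 0) (ht : t ≠ 0) (hrst : r + s + t = 0) (hr' : r' ≠ 0) (hs' : s' ≠ 0) (ht' : t' ≠ 0) (hrst' : r' + s' + t' = 0)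
    (hprim : ∀ q : ℕ, q.Prime → q ∣ N → ¬(q ∣ r.val ∧ q ∣ s.val ∧ q ∣ t.val))
    (hprim' : ∀ q : ℕ, q.Prime → q ∣ N → ¬(q ∣ r'.val ∧ q ∣ s'.val ∧ q ∣ t'.val))
    (hpr : p ∣ r.val) (hqst : q ∣ s.val ∨ q ∣ t.val)
    (hS : IsCMResidueSet N (fermatCMType N r s t)) (hS' : IsCMResidueSet N (fermatCMType N r' s' t'))
    (hA : IsCMTypeRealisation (cmTypeOfResidues (L := L) (fermatCMType N r s t) hS.cm) A ι θ)
    (hA' : IsCMTypeRealisation (cmTypeOfResidues (L := L) (fermatCMType N r' s' t') hS'.cm) A' ι' θ') :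
    AbelianVariety.IsIsogenous A A' ↔ ∃ u : ZMod N, IsUnit u ∧ ({r', s', t'} : Multiset (ZMod N)) = {u * r, u * s, u * t} := by
  rw [isIsogenous_fermatCMType_iff_exists_eq_mul hS hS' hA hA']
  refine ⟨fun ⟨u, hu, hEq⟩ => ⟨u, hu, ?_⟩, fun ⟨u, hu, h⟩ => ⟨u, hu, fermatCMType_eq_of_multiset_eq h⟩⟩
  have hur : u * r ≠ 0 := fun h => hr (hu.mul_right_eq_zero.1 h)
  have hus : u * s ≠ 0 := fun h => hs (hu.mul_right_eq_zero.1 h)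
  have hut : u * t ≠ 0 := fun h => ht (hu.mul_right_eq_zero.1 h)
  have hsum : u * r + u * s + u * t = 0 := by rw [← mul_add, ← mul_add, hrst, mul_zero]
  have hprimu : ∀ q : ℕ, q.Prime → q ∣ N → ¬(q ∣ (u * r).val ∧ q ∣ (u * s).val ∧ q ∣ (u * t).val) := fun q hq hqN h =>
    hprim q hq hqN ⟨(dvd_val_mul_iff_of_isUnit_ct hqN hu r).1 h.1, (dvd_val_mul_iff_of_isUnit_ct hqN hu s).1 h.2.1,
      (dvd_val_mul_iff_of_isUnit_ct hqN hu t).1 h.2.2⟩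
  exact (multiset_eq_of_fermatCMType_eq_of_dvd_of_dvd_all hN2 hN3 hp hpN hq hqN hur hus hut hsum hr' hs' ht' hrst' hprimu hprim'
    hEq.symm ((dvd_val_mul_iff_of_isUnit_ct hpN hu r).2 hpr)
    (hqst.imp (fun h => (dvd_val_mul_iff_of_isUnit_ct hqN hu s).2 h) fun h => (dvd_val_mul_iff_of_isUnit_ct hqN hu t).2 h)).symm

end AssemblyAll

end CyclotomicFermatCMType

end Literature.AlgebraicGeometry.ComplexMultiplication
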